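import Literature.Computability.FineGrained.DTWTraversalBounds
import Mathlib.Algebra.Order.BigOperators.Group.List
import Mathlib.Algebra.BigOperators.Intervals
import Mathlib.Data.List.GetD
import HarnessLib

/-!
# The alignment gadget for one-dimensional dynamic time warping

The (unbalanced) alignment gadget of K. Bringmann, M. Künnemann, *Quadratic conditional lower
bounds for string problems and dynamic time warping*, FOCS 2015 (arXiv:1502.01063), **Def. 6.2**,
for DTW on one-dimensional curves: given gadgets `X₀, …, X_{N-1}` and `Y₀, …, Y_{m-1}` (integer
sequences with values in `[0, z]`) and `M = 2z`, the curves

  `ga M κ Xs = M^κ X₀ M^κ X₁ ⋯ X_{N-1} M^κ`, `ga M κ Ys = M^κ Y₀ M^κ ⋯ Y_{m-1} M^κ`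

(`M^κ` = `κ` copies of the point `M`), and the two halves of its analysis (BK15 **Lemma 6.3**,
"Def. 6.2 realizes an unbalanced alignment gadget"), in the form consumed by the reduction from
Orthogonal Vectors (BK15 §3.1):

* **upper bound** (`dtwDist_ga_ga_le_shift`, the traversal of BK15 Fig. 4): for every shift `Δ`
  with `Δ + m ≤ N`, `dtwDist x y ≤ Σ_{skipped X} Σ_{v ∈ X} |v - M| + Σ_j dtwDist X_{Δ+j} Y_j`;
* **lower bound** (`le_dtwDist_ga_ga`): if all `X_i` have the same length `ℓx` and the same sum
  `sx` (BK15's "type"), all `Y_j` have length `ℓy`, `κ ≥ 4 (ℓx + ℓy) + 1`, and `mv j` is a common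
  lower bound of the distances `dtwDist X_i Y_j` (`i < N`) with `mv j ≤ ℓy M - Σ Y_j`, then
  `(N - m) · (ℓx M - sx) + Σ_j mv j ≤ dtwDist x y`.

The lower bound is the weak form of the second inequality of BK15 Lemma 6.3 / Def. 3.1
("`δ(x, y) - C ≥ min over alignments A of δ(A)`") in which the minimum over alignments is
relaxed to `Σ_j min_i δ(X_i, Y_j)` — all that the OV reduction uses (BK15 Claims 3.5–3.6). **Proof technique.** Instead of the structural analysis of optimal
traversals in BK15 (the bipartite graph of paired `M`-blocks, Lemmas 6.4–6.8), we give a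
dynamic-programming dual certificate: an explicit potential on pairs of positions (§ *The
potential*) satisfying the local inequality of the DTW recursion, fed to the potential principle
`DTWRed.le_dtwDist_drop_of_local`-style induction (`DTWTraversalBounds`). The constant `4` in the
requirement on `κ` (BK15 take `κ = 3 (ℓx + ℓy)` with a finer argument) is immaterial downstream.

## References

* K. Bringmann, M. Künnemann, FOCS 2015, §3 (alignment gadgets, Def. 3.1), §6 (Def. 6.2,
  Lemma 6.3, Lemma 6.4).
-/

namespace Literature.Computability.FineGrained

open Cryptography

namespace DTWRed

/-! ### The gadget -/

/-- **The DTW alignment gadget** (Bringmann–Künnemann, FOCS 2015, Def. 6.2): the curve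
`M^κ X₀ M^κ X₁ ⋯ X_{N-1} M^κ` — the gadgets separated and enclosed by blocks of `κ` copies of the
large point `M`. The same shape is used on both sides. [cite: BringmannKunnemannFOCS2015, Def. 6.2] -/
def ga (M : ℤ) (κ : ℕ) (Xs : List (List ℤ)) : List ℤ :=
  List.replicate κ M ++ (Xs.map fun X => X ++ List.replicate κ M).flatten

/-- `ga` of no gadget is one block. [folklore] -/
@[simp] theorem ga_nil (M : ℤ) (κ : ℕ) : ga M κ [] = List.replicate κ M := by simp [ga]

/-- Peeling the first gadget: `ga M κ (X :: Xs) = M^κ ++ X ++ ga M κ Xs`. [folklore] -/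
theorem ga_cons (M : ℤ) (κ : ℕ) (X : List ℤ) (Xs : List (List ℤ)) :
    ga M κ (X :: Xs) = (List.replicate κ M ++ X) ++ ga M κ Xs := by
  simp [ga, List.append_assoc]

/-- Peeling a prefix of gadgets: `ga M κ (P ++ Xs) = (P.map (M^κ ++ ·)).flatten ++ ga M κ Xs`.
[folklore] -/
theorem ga_append (M : ℤ) (κ : ℕ) (P Xs : List (List ℤ)) :
    ga M κ (P ++ Xs) = (P.map fun X => List.replicate κ M ++ X).flatten ++ ga M κ Xs := by
  induction P with
  | nil => simp
  | cons X P ih => rw [List.cons_append, ga_cons, ih]; simp [List.append_assoc]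

/-- The length of the gadget curve. [folklore] -/
theorem length_ga (M : ℤ) (κ : ℕ) (Xs : List (List ℤ)) :
    (ga M κ Xs).length = κ + (Xs.map fun X => X.length + κ).sum := by
  induction Xs with
  | nil => simp
  | cons X Xs ih =>
    rw [ga_cons, List.length_append, List.length_append, List.length_replicate, ih]
    simp; ring

/-- `ga M κ Xs` starts with the point `M` when `κ ≥ 1`. [folklore] -/
theorem ga_eq_cons (M : ℤ) {κ : ℕ} (hκ : 1 ≤ κ) (Xs : List (List ℤ)) :
    ga M κ Xs = M :: (List.replicate (κ - 1) M ++ (Xs.map fun X => X ++ List.replicate κ M).flatten) := by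
  obtain ⟨k, rfl⟩ := Nat.exists_eq_add_of_le' hκ
  simp [ga, List.replicate_succ]

/-- `ga M κ Xs` is nonempty when `κ ≥ 1`. [folklore] -/
theorem ga_ne_nil (M : ℤ) {κ : ℕ} (hκ : 1 ≤ κ) (Xs : List (List ℤ)) : ga M κ Xs ≠ [] := by
  rw [ga_eq_cons M hκ]; simp

/-- Every point of `ga M κ Xs` is `M` or a point of some gadget. [folklore] -/
theorem mem_ga_iff (M : ℤ) {κ : ℕ} (hκ : 1 ≤ κ) (Xs : List (List ℤ)) (v : ℤ) :
    v ∈ ga M κ Xs ↔ v = M ∨ ∃ X ∈ Xs, v ∈ X := by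
  have hk : κ ≠ 0 := by omega
  simp only [ga, List.mem_append, List.mem_replicate, List.mem_flatten, List.mem_map]
  constructor
  · rintro (⟨-, rfl⟩ | ⟨l, ⟨X, hX, rfl⟩, hv⟩)
    · exact Or.inl rfl
    · simp only [List.mem_append, List.mem_replicate] at hv
      rcases hv with hv | ⟨-, rfl⟩
      · exact Or.inr ⟨X, hX, hv⟩
      · exact Or.inl rfl
  · rintro (rfl | ⟨X, hX, hv⟩)
    · exact Or.inl ⟨hk, rfl⟩
    · exact Or.inr ⟨_, ⟨X, hX, rfl⟩, by simp [hv]⟩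

/-! ### The skip cost of a gadget -/

/-- The cost `Σ_{v ∈ X} |v - M|` of coupling every point of `X` with the point `M` ("skipping"
the gadget `X`; BK15 Lemma 6.4(1): `δ(x_i, M) = ℓ_x M - s_x`). [cite: BringmannKunnemannFOCS2015, Lemma 6.4(1)] -/
def skipCost (M : ℤ) (X : List ℤ) : ℕ∞ := (X.map fun v => ((v - M).natAbs : ℕ∞)).sum

/-- The skip cost of a block of `M`'s followed by `X` is that of `X`. [folklore] -/
theorem sum_map_cost_replicate_append (M : ℤ) (κ : ℕ) (X : List ℤ) :
    ((List.replicate κ M ++ X).map fun v => ((v - M).natAbs : ℕ∞)).sum = skipCost M X := by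
  simp [skipCost]

/-- The skip cost of a concatenation of blocks `M^κ ++ X`. [folklore] -/
theorem sum_map_cost_flatten (M : ℤ) (κ : ℕ) (P : List (List ℤ)) :
    (((P.map fun X => List.replicate κ M ++ X).flatten).map fun v => ((v - M).natAbs : ℕ∞)).sum =
      (P.map (skipCost M)).sum := by
  induction P with
  | nil => simp
  | cons X P ih =>
    rw [List.map_cons, List.flatten_cons, List.map_append, List.sum_append, ih,
      sum_map_cost_replicate_append, List.map_cons, List.sum_cons]

/-! ### Upper bound: the structured traversals -/

/-- Skipping a prefix of gadgets against the first point `M` of the other curve: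
`dtwDist (ga M κ (P ++ Xs)) (ga M κ Ys) ≤ Σ_{X ∈ P} skipCost M X + dtwDist (ga M κ Xs) (ga M κ Ys)`.
[cite: BringmannKunnemannFOCS2015, Lemma 6.3 (proof, first phase of the traversal)] -/
theorem dtwDist_ga_append_le (M : ℤ) {κ : ℕ} (hκ : 1 ≤ κ) (P Xs Ys : List (List ℤ)) :
    dtwDist (ga M κ (P ++ Xs)) (ga M κ Ys) ≤ (P.map (skipCost M)).sum + dtwDist (ga M κ Xs) (ga M κ Ys) := by
  rw [ga_append, ga_eq_cons M hκ Ys, ← sum_map_cost_flatten M κ P]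
  exact dtwDist_append_cons_le _ _ _ _

/-- Coupling the first gadgets with each other and the leading blocks diagonally:
`dtwDist (ga M κ (X :: Xs)) (ga M κ (Y :: Ys)) ≤ dtwDist X Y + dtwDist (ga M κ Xs) (ga M κ Ys)`.
[cite: BringmannKunnemannFOCS2015, Lemma 6.3 (proof, middle phase of the traversal)] -/
theorem dtwDist_ga_cons_cons_le (M : ℤ) {κ : ℕ} (hκ : 1 ≤ κ) (X Y : List ℤ) (Xs Ys : List (List ℤ)) :
    dtwDist (ga M κ (X :: Xs)) (ga M κ (Y :: Ys)) ≤ dtwDist X Y + dtwDist (ga M κ Xs) (ga M κ Ys) := by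
  rw [ga_cons, ga_cons]
  refine (dtwDist_append_append_le _ _ _ _).trans (add_le_add_left ?_ _)
  refine (dtwDist_append_append_le _ _ _ _).trans ?_
  rw [dtwDist_replicate_replicate M (by omega) (by omega), zero_add]

/-- Skipping all remaining gadgets against the last block:
`dtwDist (ga M κ Xs) (ga M κ []) ≤ Σ_{X ∈ Xs} skipCost M X`.
[cite: BringmannKunnemannFOCS2015, Lemma 6.3 (proof, last phase of the traversal)] -/
theorem dtwDist_ga_nil_le (M : ℤ) {κ : ℕ} (hκ : 1 ≤ κ) (Xs : List (List ℤ)) :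
    dtwDist (ga M κ Xs) (ga M κ []) ≤ (Xs.map (skipCost M)).sum := by
  have h := dtwDist_ga_append_le M hκ Xs [] []
  rw [List.append_nil] at h
  refine h.trans ?_
  rw [ga_nil, dtwDist_replicate_replicate M (by omega) (by omega), add_zero]

/-- Aligned phase by induction: `dtwDist (ga M κ Xs) (ga M κ Ys) ≤ Σ_{j} dtwDist X_j Y_j +
Σ_{i ≥ m} skipCost M X_i` when `m ≤ N`. [cite: BringmannKunnemannFOCS2015, Lemma 6.3 (proof)] -/
theorem dtwDist_ga_ga_le_aligned (M : ℤ) {κ : ℕ} (hκ : 1 ≤ κ) :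
    ∀ (Xs Ys : List (List ℤ)), Ys.length ≤ Xs.length →
      dtwDist (ga M κ Xs) (ga M κ Ys) ≤
        (List.zipWith dtwDist Xs Ys).sum + ((Xs.drop Ys.length).map (skipCost M)).sum
  | Xs, [], _ => by simpa using dtwDist_ga_nil_le M hκ Xs
  | [], _ :: _, h => by simp at h
  | X :: Xs, Y :: Ys, h => by
    rw [List.zipWith_cons_cons, List.sum_cons, List.length_cons, List.drop_succ_cons, add_assoc]
    exact (dtwDist_ga_cons_cons_le M hκ X Y Xs Ys).trans
      (add_le_add_right (dtwDist_ga_ga_le_aligned M hκ Xs Ys (by simpa using h)) _)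

/-- **Upper bound for the alignment gadget (the structured traversal with shift `Δ`,
Bringmann–Künnemann, FOCS 2015, Lemma 6.3, first displayed inequality).** For `Δ + m ≤ N`:
skip `X₀, …, X_{Δ-1}` against the first `M` of `y`, couple `X_{Δ+j}` with `Y_j` optimally and the
separating blocks diagonally, and skip the remaining gadgets against the last `M`:
`dtwDist x y ≤ Σ_{i < Δ} skip X_i + Σ_j dtwDist X_{Δ+j} Y_j + Σ_{i ≥ Δ+m} skip X_i`.
[cite: BringmannKunnemannFOCS2015, Lemma 6.3] -/
theorem dtwDist_ga_ga_le_shift (M : ℤ) {κ : ℕ} (hκ : 1 ≤ κ) (Xs Ys : List (List ℤ)) (Δ : ℕ)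
    (hΔ : Δ + Ys.length ≤ Xs.length) :
    dtwDist (ga M κ Xs) (ga M κ Ys) ≤
      ((Xs.take Δ).map (skipCost M)).sum + (List.zipWith dtwDist (Xs.drop Δ) Ys).sum +
        ((Xs.drop (Δ + Ys.length)).map (skipCost M)).sum := by
  have h₁ := dtwDist_ga_append_le M hκ (Xs.take Δ) (Xs.drop Δ) Ys
  rw [List.take_append_drop] at h₁
  have h₂ := dtwDist_ga_ga_le_aligned M hκ (Xs.drop Δ) Ys (by rw [List.length_drop]; omega)
  rw [List.drop_drop] at h₂
  rw [add_assoc]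
  exact h₁.trans (add_le_add_right h₂ _)


/-! ### Lower bound: the setting -/

/-- The data of an instance of the alignment gadget for the lower bound: the value bound `z`
(so `M = 2z`), the block length `κ`, the common gadget lengths `ℓx`, `ℓy`, the common sum `sx`
of the `X`-gadgets, the gadgets, and the claimed per-column lower bounds `mv j ≤ δ(X_i, Y_j)`.
[cite: BringmannKunnemannFOCS2015, Def. 6.2 and Lemma 6.3] -/
structure GASetup where
  /-- All gadget values lie in `[0, z]`; the separator value is `M = 2z`. -/
  z : ℕ
  /-- Length of the separating blocks `M^κ`. -/
  κ : ℕ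
  /-- Common length of the `X`-gadgets. -/
  ℓx : ℕ
  /-- Common length of the `Y`-gadgets. -/
  ℓy : ℕ
  /-- Common sum of the `X`-gadgets (BK15's "type"). -/
  sx : ℤ
  /-- The `X`-gadgets `X₀, …, X_{N-1}`. -/
  Xs : List (List ℤ)
  /-- The `Y`-gadgets `Y₀, …, Y_{m-1}`. -/
  Ys : List (List ℤ)
  /-- Claimed common lower bounds: `mv j ≤ dtwDist X_i Y_j` for all `i`. -/
  mv : ℕ → ℕ

namespace GASetup

variable (G : GASetup)

/-- The separator value `M = 2z`. [cite: BringmannKunnemannFOCS2015, Def. 6.2] -/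
def M : ℤ := 2 * (G.z : ℤ)
/-- The number `N` of `X`-gadgets. [folklore] -/
def N : ℕ := G.Xs.length
/-- The number `m` of `Y`-gadgets. [folklore] -/
def m : ℕ := G.Ys.length
/-- The `i`-th `X`-gadget (empty past the end). [folklore] -/
def X (i : ℕ) : List ℤ := G.Xs.getD i []
/-- The `j`-th `Y`-gadget (empty past the end). [folklore] -/
def Y (j : ℕ) : List ℤ := G.Ys.getD j []
/-- The `t`-th point of `X_i` (`0` past the end). [folklore] -/
def xv (i t : ℕ) : ℤ := (G.X i).getD t 0
/-- The `u`-th point of `Y_j` (`0` past the end). [folklore] -/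
def yv (j u : ℕ) : ℤ := (G.Y j).getD u 0
/-- The skip cost `σ = ℓx M - sx` of an `X`-gadget (BK15: `ℓ_x M - s_x`).
[cite: BringmannKunnemannFOCS2015, Lemma 6.4(1)] -/
def σ : ℤ := (G.ℓx : ℤ) * G.M - G.sx
/-- The skip cost `λ_j = ℓy M - Σ Y_j` of the gadget `Y_j`. [cite: BringmannKunnemannFOCS2015, Lemma 6.4(1)] -/
def lam (j : ℕ) : ℤ := (G.ℓy : ℤ) * G.M - (G.Y j).sum
/-- The remaining skip mass `τ_i(t) = Σ_{t' ≥ t} (M - X_i[t'])` of `X_i` from position `t`. [folklore] -/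
def τ (i t : ℕ) : ℤ := (((G.X i).drop t).map fun v => G.M - v).sum
/-- The remaining skip mass `υ_j(u) = Σ_{u' ≥ u} (M - Y_j[u'])` of `Y_j` from position `u`. [folklore] -/
def υ (j u : ℕ) : ℤ := (((G.Y j).drop u).map fun v => G.M - v).sum
/-- The claimed bounds of the remaining columns: `Ssum j = Σ_{j ≤ k < m} mv k`. [folklore] -/
def Ssum (j : ℕ) : ℤ := ∑ k ∈ Finset.Ico j G.m, (G.mv k : ℤ)
/-- The base bound `R a b S = S + σ · (a ∸ b)` for `a` remaining `X`-gadgets, `b` remaining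
`Y`-gadgets with claimed bounds summing to `S`. [folklore] -/
def R (a b : ℕ) (S : ℤ) : ℤ := S + G.σ * ((a - b : ℕ) : ℤ)
/-- The distance of the suffixes `X_i[t..]`, `Y_j[u..]`, as a natural number (`0` if infinite).
[folklore] -/
def pd (i t j u : ℕ) : ℕ := (dtwDist ((G.X i).drop t) ((G.Y j).drop u)).toNat

/-- The hypotheses of the lower bound (Bringmann–Künnemann, FOCS 2015, Lemma 6.3, with our
constants): nonempty gadgets of common length (and common sum on the `X`-side), values in
`[0, z]`, `κ ≥ 4 (ℓx + ℓy) + 1`, at least one `X`-gadget, and the claimed column bounds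
`mv j ≤ δ(X_i, Y_j)` together with `mv j ≤ λ_j`. [cite: BringmannKunnemannFOCS2015, Lemma 6.3] -/
structure WF : Prop where
  /-- `X`-gadgets are nonempty. -/
  one_le_ℓx : 1 ≤ G.ℓx
  /-- `Y`-gadgets are nonempty. -/
  one_le_ℓy : 1 ≤ G.ℓy
  /-- The blocks are long: `κ ≥ 4 (ℓx + ℓy) + 1`. -/
  κ_ge : 4 * (G.ℓx + G.ℓy) + 1 ≤ G.κ
  /-- There is at least one `X`-gadget. -/
  N_pos : 1 ≤ G.N
  /-- Common length of the `X`-gadgets. -/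
  len_X : ∀ i, i < G.N → (G.X i).length = G.ℓx
  /-- Common sum of the `X`-gadgets. -/
  sum_X : ∀ i, i < G.N → (G.X i).sum = G.sx
  /-- Values of the `X`-gadgets lie in `[0, z]`. -/
  val_X : ∀ i, i < G.N → ∀ v ∈ G.X i, 0 ≤ v ∧ v ≤ G.z
  /-- Common length of the `Y`-gadgets. -/
  len_Y : ∀ j, j < G.m → (G.Y j).length = G.ℓy
  /-- Values of the `Y`-gadgets lie in `[0, z]`. -/
  val_Y : ∀ j, j < G.m → ∀ v ∈ G.Y j, 0 ≤ v ∧ v ≤ G.z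
  /-- The claimed column bounds hold. -/
  mv_le : ∀ i, i < G.N → ∀ j, j < G.m → (G.mv j : ℕ∞) ≤ dtwDist (G.X i) (G.Y j)
  /-- The claimed column bounds are at most the skip costs of the columns. -/
  mv_le_lam : ∀ j, j < G.m → (G.mv j : ℤ) ≤ G.lam j

/-! ### Elementary consequences of the hypotheses -/

section facts

variable {G}

/-- `M = 2z ≥ 0`. [folklore] -/
theorem M_nonneg : 0 ≤ G.M := by unfold M; positivity

/-- A point of an `X`-gadget. [folklore] -/
theorem xv_mem (hW : G.WF) {i t : ℕ} (hi : i < G.N) (ht : t < G.ℓx) : G.xv i t ∈ G.X i := by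
  unfold xv; rw [List.getD_eq_getElem _ _ (by rw [hW.len_X i hi]; exact ht)]; exact List.getElem_mem _

/-- A point of a `Y`-gadget. [folklore] -/
theorem yv_mem (hW : G.WF) {j u : ℕ} (hj : j < G.m) (hu : u < G.ℓy) : G.yv j u ∈ G.Y j := by
  unfold yv; rw [List.getD_eq_getElem _ _ (by rw [hW.len_Y j hj]; exact hu)]; exact List.getElem_mem _

/-- Bounds of a point of an `X`-gadget: `0 ≤ X_i[t] ≤ z`. [folklore] -/
theorem xv_bounds (hW : G.WF) {i t : ℕ} (hi : i < G.N) (ht : t < G.ℓx) : 0 ≤ G.xv i t ∧ G.xv i t ≤ G.z :=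
  hW.val_X i hi _ (xv_mem hW hi ht)

/-- Bounds of a point of a `Y`-gadget: `0 ≤ Y_j[u] ≤ z`. [folklore] -/
theorem yv_bounds (hW : G.WF) {j u : ℕ} (hj : j < G.m) (hu : u < G.ℓy) : 0 ≤ G.yv j u ∧ G.yv j u ≤ G.z :=
  hW.val_Y j hj _ (yv_mem hW hj hu)

/-- Unfolding the suffix of an `X`-gadget: `X_i[t..] = X_i[t] :: X_i[t+1..]`. [folklore] -/
theorem drop_X_eq_cons (hW : G.WF) {i t : ℕ} (hi : i < G.N) (ht : t < G.ℓx) :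
    (G.X i).drop t = G.xv i t :: (G.X i).drop (t + 1) := by
  have h : t < (G.X i).length := by rw [hW.len_X i hi]; exact ht
  rw [List.drop_eq_getElem_cons h]; unfold xv; rw [List.getD_eq_getElem _ _ h]

/-- Unfolding the suffix of a `Y`-gadget. [folklore] -/
theorem drop_Y_eq_cons (hW : G.WF) {j u : ℕ} (hj : j < G.m) (hu : u < G.ℓy) :
    (G.Y j).drop u = G.yv j u :: (G.Y j).drop (u + 1) := by
  have h : u < (G.Y j).length := by rw [hW.len_Y j hj]; exact hu
  rw [List.drop_eq_getElem_cons h]; unfold yv; rw [List.getD_eq_getElem _ _ h]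

/-- The past-the-end suffix of an `X`-gadget is empty. [folklore] -/
theorem drop_X_ℓx (hW : G.WF) {i : ℕ} (hi : i < G.N) : (G.X i).drop G.ℓx = [] :=
  List.drop_eq_nil_of_le (by rw [hW.len_X i hi])

/-- The past-the-end suffix of a `Y`-gadget is empty. [folklore] -/
theorem drop_Y_ℓy (hW : G.WF) {j : ℕ} (hj : j < G.m) : (G.Y j).drop G.ℓy = [] :=
  List.drop_eq_nil_of_le (by rw [hW.len_Y j hj])

/-- Recursion of the remaining skip mass: `τ_i(t) = (M - X_i[t]) + τ_i(t+1)`. [folklore] -/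
theorem τ_succ (hW : G.WF) {i t : ℕ} (hi : i < G.N) (ht : t < G.ℓx) :
    G.τ i t = (G.M - G.xv i t) + G.τ i (t + 1) := by
  unfold τ; rw [drop_X_eq_cons hW hi ht]; simp

/-- `τ_i(ℓx) = 0`. [folklore] -/
theorem τ_ℓx (hW : G.WF) {i : ℕ} (hi : i < G.N) : G.τ i G.ℓx = 0 := by
  unfold τ; rw [drop_X_ℓx hW hi]; simp

/-- `Σ_{v ∈ L} (M - v) = |L| M - Σ L`. [folklore] -/
theorem sum_map_const_sub (L : List ℤ) (c : ℤ) :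
    (L.map fun v => c - v).sum = (L.length : ℤ) * c - L.sum := by
  induction L with
  | nil => simp
  | cons v L ih => simp [ih]; ring

/-- `τ_i(0) = σ` (common length and sum). [folklore] -/
theorem τ_zero (hW : G.WF) {i : ℕ} (hi : i < G.N) : G.τ i 0 = G.σ := by
  unfold τ σ
  rw [List.drop_zero, sum_map_const_sub, hW.len_X i hi, hW.sum_X i hi]

/-- The remaining skip mass is nonnegative. [folklore] -/
theorem τ_nonneg (hW : G.WF) {i : ℕ} (hi : i < G.N) (t : ℕ) : 0 ≤ G.τ i t := by
  unfold τ
  refine List.sum_nonneg fun w hw => ?_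
  obtain ⟨v, hv, rfl⟩ := List.mem_map.1 hw
  have := hW.val_X i hi v (List.mem_of_mem_drop hv)
  unfold M; omega

/-- The remaining skip mass is at least `z` per remaining point: `(ℓx - t) z ≤ τ_i(t)`. [folklore] -/
theorem mul_le_τ (hW : G.WF) {i : ℕ} (hi : i < G.N) (t : ℕ) : ((G.ℓx - t : ℕ) : ℤ) * G.z ≤ G.τ i t := by
  unfold τ
  have hlen : ((G.X i).drop t).length = G.ℓx - t := by rw [List.length_drop, hW.len_X i hi]
  rw [← hlen]
  have : ∀ (L : List ℤ), (∀ v ∈ L, 0 ≤ v ∧ v ≤ G.z) → ((L.length : ℕ) : ℤ) * G.z ≤ (L.map fun v => G.M - v).sum := by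
    intro L hL
    induction L with
    | nil => simp
    | cons v L ih =>
      simp only [List.length_cons, Nat.cast_succ, List.map_cons, List.sum_cons]
      have h1 := hL v (by simp)
      have h2 := ih (fun w hw => hL w (by simp [hw]))
      unfold M at *; nlinarith
  exact this _ fun v hv => hW.val_X i hi v (List.mem_of_mem_drop hv)

/-- `τ_i(t) ≤ σ` and the consumed mass is at least `t z`: `t z ≤ σ - τ_i(t)` for `t ≤ ℓx`. [folklore] -/
theorem mul_le_σ_sub_τ (hW : G.WF) {i t : ℕ} (hi : i < G.N) (ht : t ≤ G.ℓx) : (t : ℤ) * G.z ≤ G.σ - G.τ i t := by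
  -- σ - τ i t = Σ_{v ∈ take t} (M - v)
  have hsplit : G.σ = (((G.X i).take t).map fun v => G.M - v).sum + G.τ i t := by
    rw [← τ_zero hW hi]; unfold τ
    rw [List.drop_zero, ← List.sum_append, ← List.map_append, List.take_append_drop]
  have hlen : ((G.X i).take t).length = t := by rw [List.length_take, hW.len_X i hi]; omega
  have : ∀ (L : List ℤ), (∀ v ∈ L, 0 ≤ v ∧ v ≤ G.z) → ((L.length : ℕ) : ℤ) * G.z ≤ (L.map fun v => G.M - v).sum := by
    intro L hL
    induction L with
    | nil => simp
    | cons v L ih =>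
      simp only [List.length_cons, Nat.cast_succ, List.map_cons, List.sum_cons]
      have h1 := hL v (by simp)
      have h2 := ih (fun w hw => hL w (by simp [hw]))
      unfold M at *; nlinarith
  have h := this ((G.X i).take t) fun v hv => hW.val_X i hi v (List.mem_of_mem_take hv)
  rw [hlen] at h
  linarith

/-- `σ ≥ ℓx z ≥ 0`. [folklore] -/
theorem σ_nonneg (hW : G.WF) : 0 ≤ G.σ := by
  have h0 : 0 < G.N := hW.N_pos
  have := mul_le_σ_sub_τ hW h0 (le_refl G.ℓx)
  rw [τ_ℓx hW h0] at this
  have hz : (0 : ℤ) ≤ (G.ℓx : ℤ) * G.z := by positivity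
  linarith

/-- `σ ≤ ℓx M = 2 ℓx z`. [folklore] -/
theorem σ_le (hW : G.WF) : G.σ ≤ 2 * (G.ℓx : ℤ) * G.z := by
  have h0 : 0 < G.N := hW.N_pos
  have hs : 0 ≤ G.sx := by
    rw [← hW.sum_X 0 h0]
    exact List.sum_nonneg fun v hv => (hW.val_X 0 h0 v hv).1
  unfold σ M; nlinarith

/-- Recursion of `υ`: `υ_j(u) = (M - Y_j[u]) + υ_j(u+1)`. [folklore] -/
theorem υ_succ (hW : G.WF) {j u : ℕ} (hj : j < G.m) (hu : u < G.ℓy) :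
    G.υ j u = (G.M - G.yv j u) + G.υ j (u + 1) := by
  unfold υ; rw [drop_Y_eq_cons hW hj hu]; simp

/-- `υ_j(ℓy) = 0`. [folklore] -/
theorem υ_ℓy (hW : G.WF) {j : ℕ} (hj : j < G.m) : G.υ j G.ℓy = 0 := by
  unfold υ; rw [drop_Y_ℓy hW hj]; simp

/-- `υ_j(0) = λ_j`. [folklore] -/
theorem υ_zero (hW : G.WF) {j : ℕ} (hj : j < G.m) : G.υ j 0 = G.lam j := by
  unfold υ lam
  rw [List.drop_zero, sum_map_const_sub, hW.len_Y j hj]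

/-- `υ` is nonnegative. [folklore] -/
theorem υ_nonneg (hW : G.WF) {j : ℕ} (hj : j < G.m) (u : ℕ) : 0 ≤ G.υ j u := by
  unfold υ
  refine List.sum_nonneg fun w hw => ?_
  obtain ⟨v, hv, rfl⟩ := List.mem_map.1 hw
  have := hW.val_Y j hj v (List.mem_of_mem_drop hv)
  unfold M; omega

/-- The consumed mass of a column is at least `u z`: `u z ≤ λ_j - υ_j(u)` for `u ≤ ℓy`. [folklore] -/
theorem mul_le_lam_sub_υ (hW : G.WF) {j u : ℕ} (hj : j < G.m) (hu : u ≤ G.ℓy) : (u : ℤ) * G.z ≤ G.lam j - G.υ j u := by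
  have hsplit : G.lam j = (((G.Y j).take u).map fun v => G.M - v).sum + G.υ j u := by
    rw [← υ_zero hW hj]; unfold υ
    rw [List.drop_zero, ← List.sum_append, ← List.map_append, List.take_append_drop]
  have hlen : ((G.Y j).take u).length = u := by rw [List.length_take, hW.len_Y j hj]; omega
  have : ∀ (L : List ℤ), (∀ v ∈ L, 0 ≤ v ∧ v ≤ G.z) → ((L.length : ℕ) : ℤ) * G.z ≤ (L.map fun v => G.M - v).sum := by
    intro L hL
    induction L with
    | nil => simp
    | cons v L ih =>
      simp only [List.length_cons, Nat.cast_succ, List.map_cons, List.sum_cons]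
      have h1 := hL v (by simp)
      have h2 := ih (fun w hw => hL w (by simp [hw]))
      unfold M at *; nlinarith
  have h := this ((G.Y j).take u) fun v hv => hW.val_Y j hj v (List.mem_of_mem_take hv)
  rw [hlen] at h
  linarith

/-- `λ_j ≤ ℓy M = 2 ℓy z`. [folklore] -/
theorem lam_le (hW : G.WF) {j : ℕ} (hj : j < G.m) : G.lam j ≤ 2 * (G.ℓy : ℤ) * G.z := by
  have hs : 0 ≤ (G.Y j).sum := List.sum_nonneg fun v hv => (hW.val_Y j hj v hv).1
  unfold lam M; nlinarith

/-- Splitting off the first claimed column: `Ssum j = mv j + Ssum (j+1)` for `j < m`. [folklore] -/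
theorem Ssum_succ {j : ℕ} (hj : j < G.m) : G.Ssum j = G.mv j + G.Ssum (j + 1) := by
  unfold Ssum; rw [Finset.sum_eq_sum_Ico_succ_bot hj]

/-- `Ssum m = 0`. [folklore] -/
theorem Ssum_m : G.Ssum G.m = 0 := by unfold Ssum; simp

/-- `Ssum` is nonnegative. [folklore] -/
theorem Ssum_nonneg (j : ℕ) : 0 ≤ G.Ssum j := by
  unfold Ssum; exact Finset.sum_nonneg fun k _ => by positivity

/-- `R` is monotone in the number of remaining `X`-gadgets. [folklore] -/
theorem R_le_R_succ (hW : G.WF) (a b : ℕ) (S : ℤ) : G.R a b S ≤ G.R (a + 1) b S := by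
  unfold R
  have hσ := σ_nonneg hW
  have : ((a - b : ℕ) : ℤ) ≤ ((a + 1 - b : ℕ) : ℤ) := by exact_mod_cast Nat.sub_le_sub_right (Nat.le_succ a) b
  nlinarith

/-- One more `X`-gadget costs at most `σ` more: `R (a+1) b S ≤ σ + R a b S`. [folklore] -/
theorem R_succ_le (hW : G.WF) (a b : ℕ) (S : ℤ) : G.R (a + 1) b S ≤ G.σ + G.R a b S := by
  unfold R
  have hσ := σ_nonneg hW
  have : ((a + 1 - b : ℕ) : ℤ) ≤ ((a - b : ℕ) : ℤ) + 1 := by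
    have : a + 1 - b ≤ (a - b) + 1 := by omega
    exact_mod_cast this
  nlinarith

/-- Shifting one column into the claimed sum: `R a (b+1) (v + S) = v + R (a-1) b S`. [folklore] -/
theorem R_succ_right (a b : ℕ) (v S : ℤ) : G.R a (b + 1) (v + S) = v + G.R (a - 1) b S := by
  unfold R
  have : (a - (b + 1) : ℕ) = (a - 1 - b : ℕ) := by omega
  rw [this]; ring

/-- Dropping a claimed column: `R a (b+1) (v + S) ≤ v + R a b S`. [folklore] -/
theorem R_succ_right_le (hW : G.WF) (a b : ℕ) (v S : ℤ) : G.R a (b + 1) (v + S) ≤ v + G.R a b S := by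
  rw [R_succ_right]
  have h := R_le_R_succ hW (a - 1) b S
  rcases Nat.eq_zero_or_pos a with rfl | ha
  · simp
  · rw [Nat.sub_add_cancel ha] at h; linarith

/-- The suffix distance of two gadgets is finite inside the gadgets. [folklore] -/
theorem pd_cast (hW : G.WF) {i t j u : ℕ} (hi : i < G.N) (ht : t < G.ℓx) (hj : j < G.m) (hu : u < G.ℓy) :
    ((G.pd i t j u : ℕ) : ℕ∞) = dtwDist ((G.X i).drop t) ((G.Y j).drop u) := by
  unfold pd
  refine ENat.coe_toNat (dtwDist_ne_top ?_ ?_)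
  · rw [drop_X_eq_cons hW hi ht]; simp
  · rw [drop_Y_eq_cons hW hj hu]; simp

end facts

end GASetup


namespace GASetup

variable (G : GASetup)

/-! ### Lower bound: positions as states, suffixes -/

/-- A position in a gadget curve: inside the `i`-th separating block with `r` of its points still
ahead (including the current one), or inside the `i`-th gadget at offset `t`. The past-the-end
position of a curve with `n` gadgets is `blk n 0`. [folklore] -/
inductive St : Type
  /-- In the `i`-th block `M^κ`, with `r` points of the block remaining. -/
  | blk (i r : ℕ)
  /-- In the `i`-th gadget, at offset `t`. -/
  | gad (i t : ℕ)
  deriving DecidableEq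

/-- The curve from the `i`-th gadget on: `X_i M^κ X_{i+1} M^κ ⋯ X_{n-1} M^κ`. [folklore] -/
def rest (Ls : List (List ℤ)) (i : ℕ) : List ℤ :=
  ((Ls.drop i).map fun X => X ++ List.replicate G.κ G.M).flatten

/-- The suffix of the gadget curve of `Ls` from a position. [folklore] -/
def suf (Ls : List (List ℤ)) : St → List ℤ
  | .blk i r => List.replicate r G.M ++ G.rest Ls i
  | .gad i t => (Ls.getD i []).drop t ++ List.replicate G.κ G.M ++ G.rest Ls (i + 1)

/-- The next position (gadget length `len`, `n` gadgets). [folklore] -/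
def succ (len n : ℕ) : St → St
  | .blk i r => if 1 < r then .blk i (r - 1) else if i < n then .gad i 0 else .blk n 0
  | .gad i t => if t + 1 < len then .gad i (t + 1) else .blk (i + 1) G.κ

/-- Proper positions (the past-the-end position `blk n 0` excluded). [folklore] -/
def Live (len n : ℕ) : St → Prop
  | .blk i r => i ≤ n ∧ 1 ≤ r ∧ r ≤ G.κ
  | .gad i t => i < n ∧ t < len

/-- The point at a proper position. [folklore] -/
def hd (Ls : List (List ℤ)) : St → ℤ
  | .blk _ _ => G.M
  | .gad i t => (Ls.getD i []).getD t 0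

section structural

variable {G}
variable {Ls : List (List ℤ)} {len n : ℕ}

/-- A proper position is not the past-the-end position. [folklore] -/
theorem ne_end_of_live {s : St} (hs : G.Live len n s) : s ≠ .blk n 0 := by
  cases s with
  | blk i r => obtain ⟨-, hr1, -⟩ := hs; intro h; cases h; omega
  | gad i t => intro h; cases h

variable (hn : n = Ls.length)
include hn

/-- Peeling one gadget off `rest`. [folklore] -/
theorem rest_eq_append {i : ℕ} (hi : i < n) :
    G.rest Ls i = Ls.getD i [] ++ List.replicate G.κ G.M ++ G.rest Ls (i + 1) := by
  subst hn
  unfold rest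
  rw [List.drop_eq_getElem_cons hi, List.map_cons, List.flatten_cons, List.getD_eq_getElem _ _ hi,
    List.append_assoc]

/-- Past the last gadget nothing remains. [folklore] -/
theorem rest_n : G.rest Ls n = [] := by
  subst hn; unfold rest; rw [List.drop_eq_nil_of_le le_rfl]; rfl

/-- The past-the-end suffix is empty. [folklore] -/
theorem suf_end : G.suf Ls (.blk n 0) = [] := by
  simp [suf, rest_n hn]

omit hn in
/-- The whole curve is the suffix from the first block. [folklore] -/
theorem suf_start : G.suf Ls (.blk 0 G.κ) = ga G.M G.κ Ls := by
  simp [suf, rest, ga]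

/-- **Unfolding a suffix at a proper position**: the point there, then the suffix from the next
position. [folklore] -/
theorem suf_eq_cons (hlen : ∀ i, i < n → (Ls.getD i []).length = len) {s : St} (hs : G.Live len n s) :
    G.suf Ls s = G.hd Ls s :: G.suf Ls (G.succ len n s) := by
  cases s with
  | blk i r =>
    obtain ⟨hi, hr1, -⟩ := hs
    by_cases hr : 1 < r
    · rw [show G.succ len n (.blk i r) = .blk i (r - 1) by simp [succ, hr]]
      simp only [suf, hd]
      obtain ⟨k, rfl⟩ := Nat.exists_eq_add_of_le' hr1
      rw [Nat.add_sub_cancel, List.replicate_succ, List.cons_append]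
    · have hr' : r = 1 := by omega
      subst hr'
      by_cases hin : i < n
      · rw [show G.succ len n (.blk i 1) = .gad i 0 by simp [succ, hin]]
        simp only [suf, hd, List.drop_zero]
        rw [rest_eq_append hn hin]; simp
      · have hin' : i = n := by omega
        subst hin'
        rw [show G.succ len i (.blk i 1) = .blk i 0 by simp [succ]]
        simp [suf, hd, rest_n hn]
  | gad i t =>
    obtain ⟨hi, ht⟩ := hs
    have htl : t < (Ls.getD i []).length := by rw [hlen i hi]; exact ht
    by_cases h : t + 1 < len
    · rw [show G.succ len n (.gad i t) = .gad i (t + 1) by simp [succ, h]]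
      simp only [suf, hd]
      rw [List.drop_eq_getElem_cons htl, List.getD_eq_getElem _ _ htl, List.cons_append,
        List.cons_append]
    · rw [show G.succ len n (.gad i t) = .blk (i + 1) G.κ by simp [succ, h]]
      simp only [suf, hd]
      rw [List.drop_eq_getElem_cons htl, List.getD_eq_getElem _ _ htl,
        List.drop_eq_nil_of_le (by rw [hlen i hi]; omega)]
      simp

omit hn in
/-- The next position of a proper position is proper or past-the-end. [folklore] -/
theorem live_succ_or (h1 : 1 ≤ len) (hκ : 1 ≤ G.κ) {s : St} (hs : G.Live len n s) :
    G.Live len n (G.succ len n s) ∨ G.succ len n s = .blk n 0 := by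
  cases s with
  | blk i r =>
    obtain ⟨hi, hr1, hrκ⟩ := hs
    by_cases hr : 1 < r
    · rw [show G.succ len n (.blk i r) = .blk i (r - 1) by simp [succ, hr]]
      exact Or.inl ⟨hi, by omega, by omega⟩
    · by_cases hin : i < n
      · rw [show G.succ len n (.blk i r) = .gad i 0 by simp [succ, hr, hin]]
        exact Or.inl ⟨hin, by omega⟩
      · rw [show G.succ len n (.blk i r) = .blk n 0 by simp [succ, hr, hin]]
        exact Or.inr rfl
  | gad i t =>
    obtain ⟨hi, ht⟩ := hs
    by_cases h : t + 1 < len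
    · rw [show G.succ len n (.gad i t) = .gad i (t + 1) by simp [succ, h]]
      exact Or.inl ⟨hi, h⟩
    · rw [show G.succ len n (.gad i t) = .blk (i + 1) G.κ by simp [succ, h]]
      exact Or.inl ⟨by omega, hκ, le_rfl⟩

/-- The suffix at a proper position is nonempty. [folklore] -/
theorem suf_ne_nil (hlen : ∀ i, i < n → (Ls.getD i []).length = len) {s : St} (hs : G.Live len n s) :
    G.suf Ls s ≠ [] := by
  rw [suf_eq_cons hn hlen hs]; simp

end structural

/-! ### Lower bound: the potential -/

/-- **The potential.** An integer lower bound of the distance of the suffixes from a pair of proper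
positions, by cases: block/block — the base bound `R`; gadget/block and block/gadget — the minimum
of "skip the rest of the current gadget" and "cross the rest of the other curve's block, then
couple" (the crossing costs `≥ max (remaining mass, remaining block length · z)`);
gadget/gadget — finish the two current gadgets optimally (`pd`), then the base bound. See the module
docstring. [folklore] -/
def φ : St → St → ℤ
  | .blk i _, .blk j _ => G.R (G.N - i) (G.m - j) (G.Ssum j)
  | .gad i t, .blk j r' =>
      min (G.τ i t + G.R (G.N - i - 1) (G.m - j) (G.Ssum j))
        (if j < G.m then
          (G.mv j : ℤ) - G.σ + max (G.τ i t) (((r' - 1 : ℕ) : ℤ) * G.z) +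
            G.R (G.N - i - 1) (G.m - j - 1) (G.Ssum (j + 1))
         else G.τ i t + G.R (G.N - i - 1) (G.m - j) (G.Ssum j))
  | .blk i r, .gad j u =>
      min (G.υ j u + G.R (G.N - i) (G.m - j - 1) (G.Ssum (j + 1)))
        (if i < G.N then
          (G.mv j : ℤ) - G.lam j + max (G.υ j u) (((r - 1 : ℕ) : ℤ) * G.z) +
            G.R (G.N - i - 1) (G.m - j - 1) (G.Ssum (j + 1))
         else G.υ j u + G.R (G.N - i) (G.m - j - 1) (G.Ssum (j + 1)))
  | .gad i t, .gad j u => (G.pd i t j u : ℤ) + G.R (G.N - i - 1) (G.m - j - 1) (G.Ssum (j + 1))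

/-- The potential in `ℕ∞`, extended to the past-the-end positions: `0` when both curves are
exhausted, `⊤` when exactly one is. [folklore] -/
def Φ (s s' : St) : ℕ∞ :=
  if s = .blk G.N 0 ∧ s' = .blk G.m 0 then 0
  else if s = .blk G.N 0 ∨ s' = .blk G.m 0 then ⊤
  else ((G.φ s s').toNat : ℕ∞)

section potential

variable {G}

/-! #### Casting helpers -/

/-- Lifting an integer inequality `p ≤ c + q` to `ℕ∞` through `Int.toNat`. [folklore] -/
theorem toNat_le_coe_add_toNat {p q : ℤ} {c : ℕ} (h : p ≤ c + q) :
    ((p.toNat : ℕ) : ℕ∞) ≤ (c : ℕ∞) + ((q.toNat : ℕ) : ℕ∞) := by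
  have : p.toNat ≤ c + q.toNat := by omega
  exact_mod_cast this

/-- Lifting `p ≤ c` to `ℕ∞`. [folklore] -/
theorem toNat_le_coe {p : ℤ} {c : ℕ} (h : p ≤ c) : ((p.toNat : ℕ) : ℕ∞) ≤ (c : ℕ∞) := by
  have : p.toNat ≤ c := by omega
  exact_mod_cast this

/-- A sum of casts to `ℕ∞` is the cast of the sum. [folklore] -/
theorem sum_map_coe (L : List ℤ) (g : ℤ → ℕ) :
    (L.map fun v => (g v : ℕ∞)).sum = (((L.map g).sum : ℕ) : ℕ∞) := by
  rw [Nat.cast_list_sum, List.map_map]; rfl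

/-- Extracting a natural-number inequality from one in `ℕ∞`. [folklore] -/
theorem nat_le_of_enat_le {a b k : ℕ} (h : (a : ℕ∞) ≤ (b : ℕ∞) + (k : ℕ∞)) : a ≤ b + k := by
  exact_mod_cast h

/-- Pointwise comparison of costs against a bounded point with skip masses:
`Σ_{v ∈ L} |v - c| ≤ Σ_{v ∈ L} (M - v)` for values in `[0, z]`, `c ∈ [0, z]`, `M = 2z`. [folklore] -/
theorem sum_natAbs_le_sum_sub (L : List ℤ) (c : ℤ) (hL : ∀ v ∈ L, 0 ≤ v ∧ v ≤ G.z)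
    (hc : 0 ≤ c ∧ c ≤ G.z) :
    (((L.map fun v => (v - c).natAbs).sum : ℕ) : ℤ) ≤ (L.map fun v => G.M - v).sum := by
  rw [Nat.cast_list_sum, List.map_map]
  refine List.sum_le_sum fun v hv => ?_
  have := hL v hv
  simp only [Function.comp_apply, Int.natCast_natAbs]
  unfold M; rw [abs_le]; omega

/-- The same with the point on the left: `Σ_{v ∈ L} |c - v| ≤ Σ_{v ∈ L} (M - v)`. [folklore] -/
theorem sum_natAbs_le_sum_sub' (L : List ℤ) (c : ℤ) (hL : ∀ v ∈ L, 0 ≤ v ∧ v ≤ G.z)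
    (hc : 0 ≤ c ∧ c ≤ G.z) :
    (((L.map fun v => (c - v).natAbs).sum : ℕ) : ℤ) ≤ (L.map fun v => G.M - v).sum := by
  rw [Nat.cast_list_sum, List.map_map]
  refine List.sum_le_sum fun v hv => ?_
  have := hL v hv
  simp only [Function.comp_apply, Int.natCast_natAbs]
  unfold M; rw [abs_le]; omega

/-! #### The key inequalities -/

/-- **Key inequality, `X`-side.** Coupling a later column `Y_j` with the rest of a partially
consumed `X_i` cannot beat the claimed bound by more than the consumed mass:
`mv j ≤ (σ - τ_i(t)) + pd(X_i[t..], Y_j)` (couple the consumed prefix of `X_i` with `Y_j[0]`;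
each `|v - Y_j[0]| ≤ z ≤ M - v`). [folklore] -/
theorem key_x (hW : G.WF) {i j t : ℕ} (hi : i < G.N) (hj : j < G.m) (ht : t < G.ℓx) :
    (G.mv j : ℤ) ≤ (G.σ - G.τ i t) + G.pd i t j 0 := by
  have hy := drop_Y_eq_cons hW hj hW.one_le_ℓy
  rw [List.drop_zero] at hy
  have hpd := pd_cast hW hi ht hj hW.one_le_ℓy
  rw [List.drop_zero] at hpd
  have h1 := hW.mv_le i hi j hj
  rw [hy] at h1 hpd
  have h2 := h1.trans (dtwDist_le_sum_take_add_drop (G.X i) t (G.yv j 0) ((G.Y j).drop 1))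
  rw [sum_map_coe _ fun v => (v - G.yv j 0).natAbs, ← hpd] at h2
  have h3 := nat_le_of_enat_le h2
  have h4 : (((((G.X i).take t).map fun v => (v - G.yv j 0).natAbs).sum : ℕ) : ℤ) ≤ G.σ - G.τ i t := by
    refine (sum_natAbs_le_sum_sub ((G.X i).take t) (G.yv j 0)
      (fun v hv => hW.val_X i hi v (List.mem_of_mem_take hv)) (yv_bounds hW hj hW.one_le_ℓy)).trans ?_
    have hsplit : G.σ = (((G.X i).take t).map fun v => G.M - v).sum + G.τ i t := by
      rw [← τ_zero hW hi]; unfold τ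
      rw [List.drop_zero, ← List.sum_append, ← List.map_append, List.take_append_drop]
    linarith
  have h5 : ((G.mv j : ℕ) : ℤ) ≤
      ((((G.X i).take t).map fun v => (v - G.yv j 0).natAbs).sum : ℕ) + (G.pd i t j 0 : ℕ) := by
    exact_mod_cast h3
  linarith

/-- **Key inequality, `Y`-side**: `mv j ≤ (λ_j - υ_j(u)) + pd(X_i, Y_j[u..])`. [folklore] -/
theorem key_y (hW : G.WF) {i j u : ℕ} (hi : i < G.N) (hj : j < G.m) (hu : u < G.ℓy) :
    (G.mv j : ℤ) ≤ (G.lam j - G.υ j u) + G.pd i 0 j u := by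
  have hx := drop_X_eq_cons hW hi hW.one_le_ℓx
  rw [List.drop_zero] at hx
  have hpd := pd_cast hW hi hW.one_le_ℓx hj hu
  rw [List.drop_zero] at hpd
  have h1 := hW.mv_le i hi j hj
  rw [hx] at h1 hpd
  have h2 := h1.trans (dtwDist_le_sum_take_add_drop_right (G.xv i 0) ((G.X i).drop 1) (G.Y j) u)
  rw [sum_map_coe _ fun v => (G.xv i 0 - v).natAbs, ← hpd] at h2
  have h3 := nat_le_of_enat_le h2
  have h4 : (((((G.Y j).take u).map fun v => (G.xv i 0 - v).natAbs).sum : ℕ) : ℤ) ≤ G.lam j - G.υ j u := by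
    refine (sum_natAbs_le_sum_sub' ((G.Y j).take u) (G.xv i 0)
      (fun v hv => hW.val_Y j hj v (List.mem_of_mem_take hv)) (xv_bounds hW hi hW.one_le_ℓx)).trans ?_
    have hsplit : G.lam j = (((G.Y j).take u).map fun v => G.M - v).sum + G.υ j u := by
      rw [← υ_zero hW hj]; unfold υ
      rw [List.drop_zero, ← List.sum_append, ← List.map_append, List.take_append_drop]
    linarith
  have h5 : ((G.mv j : ℕ) : ℤ) ≤
      ((((G.Y j).take u).map fun v => (G.xv i 0 - v).natAbs).sum : ℕ) + (G.pd i 0 j u : ℕ) := by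
    exact_mod_cast h3
  linarith

/-- The claimed bound at the start of a coupling: `mv j ≤ pd(X_i, Y_j)`. [folklore] -/
theorem mv_le_pd (hW : G.WF) {i j : ℕ} (hi : i < G.N) (hj : j < G.m) : (G.mv j : ℤ) ≤ G.pd i 0 j 0 := by
  have h := key_x hW hi hj hW.one_le_ℓx
  rwa [τ_zero hW hi, sub_self, zero_add] at h

/-! #### The suffix distances inside a pair of gadgets -/

/-- Diagonal step of `pd`. [folklore] -/
theorem pd_le_diag (hW : G.WF) {i t j u : ℕ} (hi : i < G.N) (ht : t + 1 < G.ℓx) (hj : j < G.m) (hu : u + 1 < G.ℓy) :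
    (G.pd i t j u : ℤ) ≤ ((G.xv i t - G.yv j u).natAbs : ℤ) + G.pd i (t + 1) j (u + 1) := by
  have h0 := pd_cast (t := t) (u := u) hW hi (by omega) hj (by omega)
  have h1 := pd_cast hW hi ht hj hu
  have h := dtwDist_cons_cons_le_diag (G.xv i t) (G.yv j u) ((G.X i).drop (t + 1)) ((G.Y j).drop (u + 1))
  rw [← drop_X_eq_cons hW hi (by omega), ← drop_Y_eq_cons hW hj (by omega), ← h0, ← h1] at h
  exact_mod_cast h

/-- Step of `pd` in the `X`-gadget only. [folklore] -/
theorem pd_le_left (hW : G.WF) {i t j u : ℕ} (hi : i < G.N) (ht : t + 1 < G.ℓx) (hj : j < G.m) (hu : u < G.ℓy) :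
    (G.pd i t j u : ℤ) ≤ ((G.xv i t - G.yv j u).natAbs : ℤ) + G.pd i (t + 1) j u := by
  have h0 := pd_cast (t := t) (u := u) hW hi (by omega) hj hu
  have h1 := pd_cast hW hi ht hj hu
  have h := dtwDist_cons_cons_le_left (G.xv i t) (G.yv j u) ((G.X i).drop (t + 1)) ((G.Y j).drop (u + 1))
  rw [← drop_X_eq_cons hW hi (by omega), ← drop_Y_eq_cons hW hj hu, ← h0, ← h1] at h
  exact_mod_cast h

/-- Step of `pd` in the `Y`-gadget only. [folklore] -/
theorem pd_le_right (hW : G.WF) {i t j u : ℕ} (hi : i < G.N) (ht : t < G.ℓx) (hj : j < G.m) (hu : u + 1 < G.ℓy) :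
    (G.pd i t j u : ℤ) ≤ ((G.xv i t - G.yv j u).natAbs : ℤ) + G.pd i t j (u + 1) := by
  have h0 := pd_cast (t := t) (u := u) hW hi ht hj (by omega)
  have h1 := pd_cast hW hi ht hj hu
  have h := dtwDist_cons_cons_le_right (G.xv i t) (G.yv j u) ((G.X i).drop (t + 1)) ((G.Y j).drop (u + 1))
  rw [← drop_X_eq_cons hW hi ht, ← drop_Y_eq_cons hW hj (by omega), ← h0, ← h1] at h
  exact_mod_cast h

/-- `pd` from the last point of `X_i`: `pd(ℓx-1, u) ≤ |X_i[ℓx-1] - Y_j[u]| + υ_j(u+1)` (the last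
point of `X_i` against the rest of `Y_j`, each `|x - y| ≤ z ≤ M - y`). [folklore] -/
theorem pd_last_x_le (hW : G.WF) {i j u : ℕ} (hi : i < G.N) (hj : j < G.m) (hu : u < G.ℓy) :
    (G.pd i (G.ℓx - 1) j u : ℤ) ≤ ((G.xv i (G.ℓx - 1) - G.yv j u).natAbs : ℤ) + G.υ j (u + 1) := by
  have hℓ := hW.one_le_ℓx
  have h0 := pd_cast (t := G.ℓx - 1) (u := u) hW hi (by omega) hj hu
  have hx : (G.X i).drop (G.ℓx - 1) = [G.xv i (G.ℓx - 1)] := by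
    rw [drop_X_eq_cons hW hi (by omega), show G.ℓx - 1 + 1 = G.ℓx by omega, drop_X_ℓx hW hi]
  rw [hx, drop_Y_eq_cons hW hj hu, dtwDist_singleton_left _ _ (by simp), List.map_cons, List.sum_cons,
    sum_map_coe _ fun v => (G.xv i (G.ℓx - 1) - v).natAbs] at h0
  have h1 : (G.pd i (G.ℓx - 1) j u : ℕ) =
      (G.xv i (G.ℓx - 1) - G.yv j u).natAbs +
        (((G.Y j).drop (u + 1)).map fun v => (G.xv i (G.ℓx - 1) - v).natAbs).sum := by
    exact_mod_cast h0
  have h2 := sum_natAbs_le_sum_sub' ((G.Y j).drop (u + 1)) (G.xv i (G.ℓx - 1))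
    (fun v hv => hW.val_Y j hj v (List.mem_of_mem_drop hv)) (xv_bounds hW hi (by omega))
  unfold υ
  have h1' : ((G.pd i (G.ℓx - 1) j u : ℕ) : ℤ) = ((G.xv i (G.ℓx - 1) - G.yv j u).natAbs : ℤ) +
      ((((G.Y j).drop (u + 1)).map fun v => (G.xv i (G.ℓx - 1) - v).natAbs).sum : ℕ) := by
    exact_mod_cast h1
  linarith

/-- `pd` from the last point of `Y_j`: `pd(t, ℓy-1) ≤ |X_i[t] - Y_j[ℓy-1]| + τ_i(t+1)`. [folklore] -/
theorem pd_last_y_le (hW : G.WF) {i j t : ℕ} (hi : i < G.N) (hj : j < G.m) (ht : t < G.ℓx) :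
    (G.pd i t j (G.ℓy - 1) : ℤ) ≤ ((G.xv i t - G.yv j (G.ℓy - 1)).natAbs : ℤ) + G.τ i (t + 1) := by
  have hℓ := hW.one_le_ℓy
  have h0 := pd_cast (t := t) (u := G.ℓy - 1) hW hi ht hj (by omega)
  have hy : (G.Y j).drop (G.ℓy - 1) = [G.yv j (G.ℓy - 1)] := by
    rw [drop_Y_eq_cons hW hj (by omega), show G.ℓy - 1 + 1 = G.ℓy by omega, drop_Y_ℓy hW hj]
  rw [hy, drop_X_eq_cons hW hi ht, dtwDist_singleton_right _ _ (by simp), List.map_cons, List.sum_cons,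
    sum_map_coe _ fun v => (v - G.yv j (G.ℓy - 1)).natAbs] at h0
  have h1 : (G.pd i t j (G.ℓy - 1) : ℕ) =
      (G.xv i t - G.yv j (G.ℓy - 1)).natAbs +
        (((G.X i).drop (t + 1)).map fun v => (v - G.yv j (G.ℓy - 1)).natAbs).sum := by
    exact_mod_cast h0
  have h2 := sum_natAbs_le_sum_sub ((G.X i).drop (t + 1)) (G.yv j (G.ℓy - 1))
    (fun v hv => hW.val_X i hi v (List.mem_of_mem_drop hv)) (yv_bounds hW hj (by omega))
  unfold τ
  have h1' : ((G.pd i t j (G.ℓy - 1) : ℕ) : ℤ) = ((G.xv i t - G.yv j (G.ℓy - 1)).natAbs : ℤ) +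
      ((((G.X i).drop (t + 1)).map fun v => (v - G.yv j (G.ℓy - 1)).natAbs).sum : ℕ) := by
    exact_mod_cast h1
  linarith

/-- `pd` at the two last points is their distance. [folklore] -/
theorem pd_last_last (hW : G.WF) {i j : ℕ} (hi : i < G.N) (hj : j < G.m) :
    (G.pd i (G.ℓx - 1) j (G.ℓy - 1) : ℤ) = ((G.xv i (G.ℓx - 1) - G.yv j (G.ℓy - 1)).natAbs : ℤ) := by
  have h1 := hW.one_le_ℓx; have h2 := hW.one_le_ℓy
  have hx : (G.X i).drop (G.ℓx - 1) = [G.xv i (G.ℓx - 1)] := by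
    rw [drop_X_eq_cons hW hi (by omega), show G.ℓx - 1 + 1 = G.ℓx by omega, drop_X_ℓx hW hi]
  have hy : (G.Y j).drop (G.ℓy - 1) = [G.yv j (G.ℓy - 1)] := by
    rw [drop_Y_eq_cons hW hj (by omega), show G.ℓy - 1 + 1 = G.ℓy by omega, drop_Y_ℓy hW hj]
  have : (G.pd i (G.ℓx - 1) j (G.ℓy - 1) : ℕ) = (G.xv i (G.ℓx - 1) - G.yv j (G.ℓy - 1)).natAbs := by
    unfold pd; rw [hx, hy, dtwDist_singleton_left _ _ (by simp)]; simp
  exact_mod_cast this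

end potential

end GASetup


namespace GASetup

section moves

variable {G : GASetup}

/-! #### Costs at the four kinds of position pairs -/

/-- `|X_i[t] - M| = M - X_i[t] ≥ z`. [folklore] -/
theorem cost_gb (hW : G.WF) {i t : ℕ} (hi : i < G.N) (ht : t < G.ℓx) :
    ((G.xv i t - G.M).natAbs : ℤ) = G.M - G.xv i t ∧ (G.z : ℤ) ≤ G.M - G.xv i t := by
  have h := xv_bounds hW hi ht
  constructor
  · rw [Int.ofNat_natAbs_of_nonpos (by unfold M; omega)]; ring
  · unfold M; omega

/-- `|M - Y_j[u]| = M - Y_j[u] ≥ z`. [folklore] -/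
theorem cost_bg (hW : G.WF) {j u : ℕ} (hj : j < G.m) (hu : u < G.ℓy) :
    ((G.M - G.yv j u).natAbs : ℤ) = G.M - G.yv j u ∧ (G.z : ℤ) ≤ G.M - G.yv j u := by
  have h := yv_bounds hW hj hu
  constructor
  · rw [Int.natAbs_of_nonneg (by unfold M; omega)]
  · unfold M; omega

/-- `τ_i(t) ≤ σ`. [folklore] -/
theorem τ_le_σ (hW : G.WF) {i : ℕ} (hi : i < G.N) {t : ℕ} (ht : t ≤ G.ℓx) : G.τ i t ≤ G.σ := by
  have h := mul_le_σ_sub_τ hW hi ht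
  have : (0 : ℤ) ≤ (t : ℤ) * G.z := by positivity
  linarith

/-- `υ_j(u) ≤ λ_j`. [folklore] -/
theorem υ_le_lam (hW : G.WF) {j : ℕ} (hj : j < G.m) {u : ℕ} (hu : u ≤ G.ℓy) : G.υ j u ≤ G.lam j := by
  have h := mul_le_lam_sub_υ hW hj hu
  have : (0 : ℤ) ≤ (u : ℤ) * G.z := by positivity
  linarith

/-- `R` is monotone: `R (a-1) b S ≤ R a b S`. [folklore] -/
theorem R_pred_le (hW : G.WF) (a b : ℕ) (S : ℤ) : G.R (a - 1) b S ≤ G.R a b S := by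
  rcases Nat.eq_zero_or_pos a with rfl | ha
  · simp
  · have h := R_le_R_succ hW (a - 1) b S
    rwa [Nat.sub_add_cancel ha] at h

/-- Block bookkeeping: if `r' ≤ r'' + 1` then `(r'-1) z ≤ (r''-1) z + z` (`r'' ≥ 1`). [folklore] -/
theorem pred_mul_le {r' r'' : ℕ} (h2 : 1 ≤ r'') (h : r' ≤ r'' + 1) :
    ((r' - 1 : ℕ) : ℤ) * G.z ≤ ((r'' - 1 : ℕ) : ℤ) * G.z + G.z := by
  have h' : (r' - 1 : ℕ) ≤ (r'' - 1) + 1 := by omega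
  calc ((r' - 1 : ℕ) : ℤ) * G.z ≤ (((r'' - 1) + 1 : ℕ) : ℤ) * G.z :=
        mul_le_mul_of_nonneg_right (by exact_mod_cast h') (by positivity)
    _ = ((r'' - 1 : ℕ) : ℤ) * G.z + G.z := by push_cast; ring

/-- The block requirement in the form used: `2 λ_j + σ ≤ (κ-1) z` and `2 σ ≤ (κ-1) z`. [folklore] -/
theorem κ_facts (hW : G.WF) {j : ℕ} (hj : j < G.m) :
    2 * G.lam j + G.σ ≤ ((G.κ - 1 : ℕ) : ℤ) * G.z ∧ 2 * G.σ ≤ ((G.κ - 1 : ℕ) : ℤ) * G.z := by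
  have hκ := hW.κ_ge
  have hl := lam_le hW hj
  have hs := σ_le hW
  have hσ := σ_nonneg hW
  have hk : (4 * (G.ℓx + G.ℓy) : ℤ) ≤ ((G.κ - 1 : ℕ) : ℤ) := by
    have : 4 * (G.ℓx + G.ℓy) ≤ G.κ - 1 := by omega
    exact_mod_cast this
  have hz : (0 : ℤ) ≤ G.z := by positivity
  have hk' : (4 * (G.ℓx + G.ℓy) : ℤ) * G.z ≤ ((G.κ - 1 : ℕ) : ℤ) * G.z := mul_le_mul_of_nonneg_right hk hz
  have hmv : (0 : ℤ) ≤ G.lam j := le_trans (by positivity) (hW.mv_le_lam j hj)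
  constructor <;> nlinarith

/-- Splitting the first remaining column off the base bound:
`R a (m - j) (Ssum j) = mv j + R (a - 1) (m - j - 1) (Ssum (j + 1))` for `j < m`. [folklore] -/
theorem R_col {j : ℕ} (hj : j < G.m) (a : ℕ) :
    G.R a (G.m - j) (G.Ssum j) = G.mv j + G.R (a - 1) (G.m - j - 1) (G.Ssum (j + 1)) := by
  rw [Ssum_succ hj]
  conv_lhs => rw [show G.m - j = (G.m - j - 1) + 1 by omega]
  rw [R_succ_right]

/-- Dropping the first remaining column from the base bound:
`R a (m - j) (Ssum j) ≤ mv j + R a (m - j - 1) (Ssum (j + 1))` for `j < m`. [folklore] -/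
theorem R_col_le (hW : G.WF) {j : ℕ} (hj : j < G.m) (a : ℕ) :
    G.R a (G.m - j) (G.Ssum j) ≤ G.mv j + G.R a (G.m - j - 1) (G.Ssum (j + 1)) := by
  rw [Ssum_succ hj]
  conv_lhs => rw [show G.m - j = (G.m - j - 1) + 1 by omega]
  exact R_succ_right_le hW _ _ _ _

/-- One more `X`-gadget ahead costs at most `σ`: `R (N - i) b S ≤ σ + R (N - i - 1) b S` for
`i < N`. [folklore] -/
theorem R_row (hW : G.WF) {i : ℕ} (hi : i < G.N) (b : ℕ) (S : ℤ) :
    G.R (G.N - i) b S ≤ G.σ + G.R (G.N - i - 1) b S := by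
  have h := R_succ_le hW (G.N - i - 1) b S
  rwa [show G.N - i - 1 + 1 = G.N - i by omega] at h

/-! #### Moves from a block/block pair -/

/-- Block/block: the potential does not depend on the offsets. [folklore] -/
theorem φ_bb_bb (i j r r' r₂ r₂' : ℕ) : G.φ (.blk i r) (.blk j r') = G.φ (.blk i r₂) (.blk j r₂') := rfl

/-- Block/block, the `X`-side enters a gadget. [folklore] -/
theorem φ_bb_le_gb (hW : G.WF) {i j : ℕ} (hi : i < G.N) (r r' r'' : ℕ) :
    G.φ (.blk i r) (.blk j r') ≤ G.φ (.gad i 0) (.blk j r'') := by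
  have hA : G.R (G.N - i) (G.m - j) (G.Ssum j) ≤ G.τ i 0 + G.R (G.N - i - 1) (G.m - j) (G.Ssum j) := by
    rw [τ_zero hW hi]; exact R_row hW hi _ _
  simp only [φ]
  refine le_min hA ?_
  split_ifs with hjm
  · rw [τ_zero hW hi, R_col hjm (G.N - i)]
    have := le_max_left G.σ (((r'' - 1 : ℕ) : ℤ) * G.z)
    rw [show G.N - i - 1 = G.N - i - 1 by rfl]
    linarith
  · exact hA

/-- Block/block, the `Y`-side enters a gadget. [folklore] -/
theorem φ_bb_le_bg (hW : G.WF) {i j : ℕ} (hj : j < G.m) (r r' r'' : ℕ) :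
    G.φ (.blk i r) (.blk j r') ≤ G.φ (.blk i r'') (.gad j 0) := by
  have hml := hW.mv_le_lam j hj
  have hC2 : G.R (G.N - i) (G.m - j) (G.Ssum j) ≤ G.υ j 0 + G.R (G.N - i) (G.m - j - 1) (G.Ssum (j + 1)) := by
    rw [υ_zero hW hj]
    have := R_col_le hW hj (G.N - i)
    linarith
  simp only [φ]
  refine le_min hC2 ?_
  split_ifs with hiN
  · rw [υ_zero hW hj, R_col hj (G.N - i)]
    have := le_max_left (G.lam j) (((r'' - 1 : ℕ) : ℤ) * G.z)
    linarith
  · exact hC2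

/-- Block/block, both sides enter gadgets. [folklore] -/
theorem φ_bb_le_gg (hW : G.WF) {i j : ℕ} (hi : i < G.N) (hj : j < G.m) (r r' : ℕ) :
    G.φ (.blk i r) (.blk j r') ≤ G.φ (.gad i 0) (.gad j 0) := by
  simp only [φ]
  rw [R_col hj (G.N - i)]
  have := mv_le_pd hW hi hj
  linarith

/-- Block/block at the very end: the potential vanishes. [folklore] -/
theorem φ_bb_end (r r' : ℕ) : G.φ (.blk G.N r) (.blk G.m r') = 0 := by
  simp [φ, R, Ssum_m]

/-! #### Moves from a gadget/block pair -/

/-- Gadget/block: the `X`-side stays in its gadget (`t' ∈ {t, t+1}`), the `Y`-side stays in its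
block (`r'' ≥ r' - 1`). [folklore] -/
theorem φ_gb_le_gb (hW : G.WF) {i t t' j r' r'' : ℕ} (hi : i < G.N) (ht : t < G.ℓx) (ht' : t' < G.ℓx)
    (htt : t' = t ∨ t' = t + 1) (hr'' : 1 ≤ r'') (hr : r' ≤ r'' + 1) :
    G.φ (.gad i t) (.blk j r') ≤ ((G.xv i t - G.M).natAbs : ℤ) + G.φ (.gad i t') (.blk j r'') := by
  obtain ⟨hc, hcz⟩ := cost_gb hW hi ht
  rw [hc]
  have hτ : G.τ i t ≤ (G.M - G.xv i t) + G.τ i t' := by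
    rcases htt with rfl | rfl
    · have := (xv_bounds hW hi ht).2; unfold M; linarith
    · rw [τ_succ hW hi ht]
  have hz := pred_mul_le (G := G) hr'' hr
  simp only [φ]
  rw [← min_add_add_left]
  refine min_le_min (by linarith) ?_
  split_ifs with hjm
  · have h1 := le_max_left (G.τ i t') (((r'' - 1 : ℕ) : ℤ) * G.z)
    have h2 := le_max_right (G.τ i t') (((r'' - 1 : ℕ) : ℤ) * G.z)
    have hmax : max (G.τ i t) (((r' - 1 : ℕ) : ℤ) * G.z) ≤ (G.M - G.xv i t) + max (G.τ i t') (((r'' - 1 : ℕ) : ℤ) * G.z) :=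
      max_le (by linarith) (by linarith)
    linarith
  · linarith

/-- Gadget/block: the `X`-side leaves its gadget from its last point. [folklore] -/
theorem φ_gb_le_bb (hW : G.WF) {i j r' r₃ r'' : ℕ} (hi : i < G.N) :
    G.φ (.gad i (G.ℓx - 1)) (.blk j r') ≤ ((G.xv i (G.ℓx - 1) - G.M).natAbs : ℤ) + G.φ (.blk (i + 1) r₃) (.blk j r'') := by
  have hℓ := hW.one_le_ℓx
  obtain ⟨hc, -⟩ := cost_gb hW hi (t := G.ℓx - 1) (by omega)
  rw [hc]
  have hτ : G.τ i (G.ℓx - 1) = G.M - G.xv i (G.ℓx - 1) := by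
    rw [τ_succ hW hi (by omega), show G.ℓx - 1 + 1 = G.ℓx by omega, τ_ℓx hW hi, add_zero]
  simp only [φ]
  rw [show G.N - (i + 1) = G.N - i - 1 by omega]
  refine min_le_of_left_le ?_
  linarith

/-- Gadget/block: the `Y`-side enters its gadget (`r' = 1`), the `X`-side stays (`t' ∈ {t, t+1}`).
Uses the key inequality. [folklore] -/
theorem φ_gb_le_gg (hW : G.WF) {i t t' j : ℕ} (hi : i < G.N) (ht : t < G.ℓx) (ht' : t' < G.ℓx)
    (htt : t' = t ∨ t' = t + 1) (hj : j < G.m) :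
    G.φ (.gad i t) (.blk j 1) ≤ ((G.xv i t - G.M).natAbs : ℤ) + G.φ (.gad i t') (.gad j 0) := by
  obtain ⟨hc, hcz⟩ := cost_gb hW hi ht
  rw [hc]
  have hτ : G.τ i t ≤ (G.M - G.xv i t) + G.τ i t' := by
    rcases htt with rfl | rfl
    · have := (xv_bounds hW hi ht).2; unfold M; linarith
    · rw [τ_succ hW hi ht]
  have hkey := key_x hW hi hj ht'
  have hτ0 := τ_nonneg hW hi t
  simp only [φ, if_pos hj]
  refine min_le_of_right_le ?_
  rw [show ((1 - 1 : ℕ) : ℤ) * G.z = 0 by simp, max_eq_left hτ0]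
  linarith

/-- Gadget/block: the `X`-side leaves its gadget while the `Y`-side enters its gadget. [folklore] -/
theorem φ_gb_le_bg (hW : G.WF) {i j : ℕ} (hi : i < G.N) (hj : j < G.m) :
    G.φ (.gad i (G.ℓx - 1)) (.blk j 1) ≤
      ((G.xv i (G.ℓx - 1) - G.M).natAbs : ℤ) + G.φ (.blk (i + 1) G.κ) (.gad j 0) := by
  have hℓ := hW.one_le_ℓx
  obtain ⟨hc, -⟩ := cost_gb hW hi (t := G.ℓx - 1) (by omega)
  rw [hc]
  have hτ : G.τ i (G.ℓx - 1) = G.M - G.xv i (G.ℓx - 1) := by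
    rw [τ_succ hW hi (by omega), show G.ℓx - 1 + 1 = G.ℓx by omega, τ_ℓx hW hi, add_zero]
  have hml := hW.mv_le_lam j hj
  have hR1 := R_col_le hW hj (G.N - i - 1)
  have hR2 := R_col hj (G.N - i - 1)
  simp only [φ]
  rw [show G.N - (i + 1) = G.N - i - 1 by omega, υ_zero hW hj, ← min_add_add_left]
  refine min_le_of_left_le (le_min ?_ ?_)
  · linarith
  · split_ifs with hiN
    · have := le_max_left (G.lam j) (((G.κ - 1 : ℕ) : ℤ) * G.z)
      linarith
    · linarith

end moves

end GASetup


namespace GASetup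

section moves2

variable {G : GASetup}

/-! #### Moves from a block/gadget pair -/

/-- Block/gadget: the `Y`-side stays in its gadget (`u' ∈ {u, u+1}`), the `X`-side stays in its
block (`r₂ ≥ r - 1`). [folklore] -/
theorem φ_bg_le_bg (hW : G.WF) {i r r₂ j u u' : ℕ} (hj : j < G.m) (hu : u < G.ℓy) (hu' : u' < G.ℓy)
    (huu : u' = u ∨ u' = u + 1) (hr₂ : 1 ≤ r₂) (hr : r ≤ r₂ + 1) :
    G.φ (.blk i r) (.gad j u) ≤ ((G.M - G.yv j u).natAbs : ℤ) + G.φ (.blk i r₂) (.gad j u') := by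
  obtain ⟨hc, hcz⟩ := cost_bg hW hj hu
  rw [hc]
  have hυ : G.υ j u ≤ (G.M - G.yv j u) + G.υ j u' := by
    rcases huu with rfl | rfl
    · have := (yv_bounds hW hj hu).2; unfold M; linarith
    · rw [υ_succ hW hj hu]
  have hz := pred_mul_le (G := G) hr₂ hr
  simp only [φ]
  rw [← min_add_add_left]
  refine min_le_min (by linarith) ?_
  split_ifs with hiN
  · have h1 := le_max_left (G.υ j u') (((r₂ - 1 : ℕ) : ℤ) * G.z)
    have h2 := le_max_right (G.υ j u') (((r₂ - 1 : ℕ) : ℤ) * G.z)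
    have hmax : max (G.υ j u) (((r - 1 : ℕ) : ℤ) * G.z) ≤
        (G.M - G.yv j u) + max (G.υ j u') (((r₂ - 1 : ℕ) : ℤ) * G.z) :=
      max_le (by linarith) (by linarith)
    linarith
  · linarith

/-- Block/gadget: the `Y`-side leaves its gadget from its last point. [folklore] -/
theorem φ_bg_le_bb (hW : G.WF) {i r r₂ j r₃ : ℕ} (hj : j < G.m) :
    G.φ (.blk i r) (.gad j (G.ℓy - 1)) ≤ ((G.M - G.yv j (G.ℓy - 1)).natAbs : ℤ) + G.φ (.blk i r₂) (.blk (j + 1) r₃) := by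
  have hℓ := hW.one_le_ℓy
  obtain ⟨hc, -⟩ := cost_bg hW hj (u := G.ℓy - 1) (by omega)
  rw [hc]
  have hυ : G.υ j (G.ℓy - 1) = G.M - G.yv j (G.ℓy - 1) := by
    rw [υ_succ hW hj (by omega), show G.ℓy - 1 + 1 = G.ℓy by omega, υ_ℓy hW hj, add_zero]
  simp only [φ]
  rw [show G.m - (j + 1) = G.m - j - 1 by omega]
  refine min_le_of_left_le ?_
  linarith

/-- Block/gadget: the `X`-side enters its gadget (`r = 1`), the `Y`-side stays (`u' ∈ {u, u+1}`).
Uses the key inequality. [folklore] -/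
theorem φ_bg_le_gg (hW : G.WF) {i j u u' : ℕ} (hi : i < G.N) (hj : j < G.m) (hu : u < G.ℓy) (hu' : u' < G.ℓy)
    (huu : u' = u ∨ u' = u + 1) :
    G.φ (.blk i 1) (.gad j u) ≤ ((G.M - G.yv j u).natAbs : ℤ) + G.φ (.gad i 0) (.gad j u') := by
  obtain ⟨hc, hcz⟩ := cost_bg hW hj hu
  rw [hc]
  have hυ : G.υ j u ≤ (G.M - G.yv j u) + G.υ j u' := by
    rcases huu with rfl | rfl
    · have := (yv_bounds hW hj hu).2; unfold M; linarith
    · rw [υ_succ hW hj hu]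
  have hkey := key_y hW hi hj hu'
  have hυ0 := υ_nonneg hW hj u
  simp only [φ, if_pos hi]
  refine min_le_of_right_le ?_
  rw [show ((1 - 1 : ℕ) : ℤ) * G.z = 0 by simp, max_eq_left hυ0]
  linarith

/-- Block/gadget: the `Y`-side leaves its gadget while the `X`-side enters its gadget. [folklore] -/
theorem φ_bg_le_gb (hW : G.WF) {i j : ℕ} (hi : i < G.N) (hj : j < G.m) :
    G.φ (.blk i 1) (.gad j (G.ℓy - 1)) ≤
      ((G.M - G.yv j (G.ℓy - 1)).natAbs : ℤ) + G.φ (.gad i 0) (.blk (j + 1) G.κ) := by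
  have hℓ := hW.one_le_ℓy
  obtain ⟨hc, -⟩ := cost_bg hW hj (u := G.ℓy - 1) (by omega)
  rw [hc]
  have hυ : G.υ j (G.ℓy - 1) = G.M - G.yv j (G.ℓy - 1) := by
    rw [υ_succ hW hj (by omega), show G.ℓy - 1 + 1 = G.ℓy by omega, υ_ℓy hW hj, add_zero]
  have hrow := R_row hW hi (G.m - j - 1) (G.Ssum (j + 1))
  simp only [φ]
  rw [show G.m - (j + 1) = G.m - j - 1 by omega, τ_zero hW hi, ← min_add_add_left]
  refine min_le_of_left_le (le_min ?_ ?_)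
  · linarith
  · split_ifs with hjm
    · have hj1 : j + 1 < G.m := hjm
      have hcol := R_col hj1 (G.N - i)
      rw [show G.m - (j + 1) = G.m - j - 1 by omega] at hcol
      have := le_max_left G.σ (((G.κ - 1 : ℕ) : ℤ) * G.z)
      linarith
    · linarith

/-! #### Moves from a gadget/gadget pair -/

/-- Gadget/gadget, diagonal move inside both gadgets. [folklore] -/
theorem φ_gg_le_gg_diag (hW : G.WF) {i t j u : ℕ} (hi : i < G.N) (ht : t + 1 < G.ℓx) (hj : j < G.m) (hu : u + 1 < G.ℓy) :
    G.φ (.gad i t) (.gad j u) ≤ ((G.xv i t - G.yv j u).natAbs : ℤ) + G.φ (.gad i (t + 1)) (.gad j (u + 1)) := by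
  simp only [φ]; have := pd_le_diag hW hi ht hj hu; linarith

/-- Gadget/gadget, move inside the `X`-gadget. [folklore] -/
theorem φ_gg_le_gg_x (hW : G.WF) {i t j u : ℕ} (hi : i < G.N) (ht : t + 1 < G.ℓx) (hj : j < G.m) (hu : u < G.ℓy) :
    G.φ (.gad i t) (.gad j u) ≤ ((G.xv i t - G.yv j u).natAbs : ℤ) + G.φ (.gad i (t + 1)) (.gad j u) := by
  simp only [φ]; have := pd_le_left hW hi ht hj hu; linarith

/-- Gadget/gadget, move inside the `Y`-gadget. [folklore] -/
theorem φ_gg_le_gg_y (hW : G.WF) {i t j u : ℕ} (hi : i < G.N) (ht : t < G.ℓx) (hj : j < G.m) (hu : u + 1 < G.ℓy) :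
    G.φ (.gad i t) (.gad j u) ≤ ((G.xv i t - G.yv j u).natAbs : ℤ) + G.φ (.gad i t) (.gad j (u + 1)) := by
  simp only [φ]; have := pd_le_right hW hi ht hj hu; linarith

/-- Gadget/gadget, both leave from their last points. [folklore] -/
theorem φ_gg_le_bb (hW : G.WF) {i j r₃ r₄ : ℕ} (hi : i < G.N) (hj : j < G.m) :
    G.φ (.gad i (G.ℓx - 1)) (.gad j (G.ℓy - 1)) ≤
      ((G.xv i (G.ℓx - 1) - G.yv j (G.ℓy - 1)).natAbs : ℤ) + G.φ (.blk (i + 1) r₃) (.blk (j + 1) r₄) := by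
  simp only [φ]
  rw [pd_last_last hW hi hj, show G.N - (i + 1) = G.N - i - 1 by omega,
    show G.m - (j + 1) = G.m - j - 1 by omega]

/-- Gadget/gadget, the `X`-side leaves from its last point, the `Y`-side stays (`u' ∈ {u, u+1}`).
Needs `κ - 1 ≥ 4 (ℓx + ℓy)` (in the form `2 λ_j + σ ≤ (κ-1) z`). [folklore] -/
theorem φ_gg_le_bg (hW : G.WF) {i j u u' : ℕ} (hi : i < G.N) (hj : j < G.m) (hu : u < G.ℓy) (hu' : u' < G.ℓy)
    (huu : u' = u ∨ u' = u + 1) :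
    G.φ (.gad i (G.ℓx - 1)) (.gad j u) ≤
      ((G.xv i (G.ℓx - 1) - G.yv j u).natAbs : ℤ) + G.φ (.blk (i + 1) G.κ) (.gad j u') := by
  have hpd := pd_last_x_le hW hi hj hu
  have hυ' : G.υ j (u + 1) ≤ G.υ j u' := by
    rcases huu with rfl | rfl
    · rw [υ_succ hW hj hu]; have := (yv_bounds hW hj hu).2; unfold M; linarith
    · exact le_rfl
  have hυl : G.υ j (u + 1) ≤ G.lam j := υ_le_lam hW hj (by omega)
  obtain ⟨hκ1, -⟩ := κ_facts hW hj
  have hmv : (0 : ℤ) ≤ G.mv j := by positivity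
  simp only [φ]
  rw [show G.N - (i + 1) = G.N - i - 1 by omega, ← min_add_add_left]
  refine le_min (by linarith) ?_
  split_ifs with hiN
  · have hrow : G.R (G.N - i - 1) (G.m - j - 1) (G.Ssum (j + 1)) ≤
        G.σ + G.R (G.N - i - 1 - 1) (G.m - j - 1) (G.Ssum (j + 1)) := by
      have h := R_succ_le hW (G.N - i - 1 - 1) (G.m - j - 1) (G.Ssum (j + 1))
      rwa [show G.N - i - 1 - 1 + 1 = G.N - i - 1 by omega] at h
    have hmax := le_max_right (G.υ j u') (((G.κ - 1 : ℕ) : ℤ) * G.z)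
    linarith
  · linarith

/-- Gadget/gadget, the `Y`-side leaves from its last point, the `X`-side stays (`t' ∈ {t, t+1}`).
Needs `2 σ ≤ (κ-1) z`. [folklore] -/
theorem φ_gg_le_gb (hW : G.WF) {i t t' j : ℕ} (hi : i < G.N) (ht : t < G.ℓx) (ht' : t' < G.ℓx)
    (htt : t' = t ∨ t' = t + 1) (hj : j < G.m) :
    G.φ (.gad i t) (.gad j (G.ℓy - 1)) ≤
      ((G.xv i t - G.yv j (G.ℓy - 1)).natAbs : ℤ) + G.φ (.gad i t') (.blk (j + 1) G.κ) := by
  have hpd := pd_last_y_le hW hi hj ht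
  have hτ' : G.τ i (t + 1) ≤ G.τ i t' := by
    rcases htt with rfl | rfl
    · rw [τ_succ hW hi ht]; have := (xv_bounds hW hi ht).2; unfold M; linarith
    · exact le_rfl
  have hτσ : G.τ i (t + 1) ≤ G.σ := τ_le_σ hW hi (by omega)
  obtain ⟨-, hκ2⟩ := κ_facts hW hj
  simp only [φ]
  rw [show G.m - (j + 1) = G.m - j - 1 by omega, ← min_add_add_left]
  refine le_min (by linarith) ?_
  split_ifs with hjm
  · have hj1 : j + 1 < G.m := hjm
    have hcol := R_col hj1 (G.N - i - 1)
    rw [show G.m - (j + 1) = G.m - j - 1 by omega] at hcol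
    have hmono := R_pred_le hW (G.N - i - 1) (G.m - j - 1 - 1) (G.Ssum (j + 1 + 1))
    have hmax := le_max_right (G.τ i t') (((G.κ - 1 : ℕ) : ℤ) * G.z)
    linarith
  · linarith

end moves2

/-! ### Lower bound: local consistency and the induction -/

section assembly

variable {G : GASetup}

/-- The past-the-end positions. [folklore] -/
theorem Φ_end_end : G.Φ (.blk G.N 0) (.blk G.m 0) = 0 := by simp [Φ]

/-- The potential at a pair of proper positions. [folklore] -/
theorem Φ_of_live {s s' : St} (hs : G.Live G.ℓx G.N s) (hs' : G.Live G.ℓy G.m s') :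
    G.Φ s s' = ((G.φ s s').toNat : ℕ∞) := by
  simp [Φ, ne_end_of_live hs, ne_end_of_live hs']

/-- One move to a pair of proper positions. [folklore] -/
theorem step_live {s s' t t' : St} {c : ℕ} (ht : G.Live G.ℓx G.N t) (ht' : G.Live G.ℓy G.m t')
    (hint : G.φ s s' ≤ (c : ℤ) + G.φ t t') : ((G.φ s s').toNat : ℕ∞) ≤ (c : ℕ∞) + G.Φ t t' := by
  rw [Φ_of_live ht ht']; exact toNat_le_coe_add_toNat hint

/-- One move exhausting the `X`-curve only. [folklore] -/
theorem step_xend {s s' t' : St} {c : ℕ} (ht' : G.Live G.ℓy G.m t') :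
    ((G.φ s s').toNat : ℕ∞) ≤ (c : ℕ∞) + G.Φ (.blk G.N 0) t' := by
  rw [show G.Φ (.blk G.N 0) t' = ⊤ by simp [Φ, ne_end_of_live ht'], add_top]; exact le_top

/-- One move exhausting the `Y`-curve only. [folklore] -/
theorem step_yend {s s' t : St} {c : ℕ} (ht : G.Live G.ℓx G.N t) :
    ((G.φ s s').toNat : ℕ∞) ≤ (c : ℕ∞) + G.Φ t (.blk G.m 0) := by
  rw [show G.Φ t (.blk G.m 0) = ⊤ by simp [Φ, ne_end_of_live ht], add_top]; exact le_top

/-- One move exhausting both curves. [folklore] -/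
theorem step_end {s s' : St} {c : ℕ} (h : G.φ s s' ≤ (c : ℤ)) :
    ((G.φ s s').toNat : ℕ∞) ≤ (c : ℕ∞) + G.Φ (.blk G.N 0) (.blk G.m 0) := by
  rw [Φ_end_end, add_zero]; exact toNat_le_coe h

/-- Successor computations. [folklore] -/
theorem succ_blk_of_lt {len n i r : ℕ} (hr : 1 < r) : G.succ len n (.blk i r) = .blk i (r - 1) := by
  simp [succ, hr]
/-- Successor computations. [folklore] -/
theorem succ_blk_one_of_lt {len n i : ℕ} (hi : i < n) : G.succ len n (.blk i 1) = .gad i 0 := by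
  simp [succ, hi]
/-- Successor computations. [folklore] -/
theorem succ_blk_one_self {len n : ℕ} : G.succ len n (.blk n 1) = .blk n 0 := by simp [succ]
/-- Successor computations. [folklore] -/
theorem succ_gad_of_lt {len n i t : ℕ} (ht : t + 1 < len) : G.succ len n (.gad i t) = .gad i (t + 1) := by
  simp [succ, ht]
/-- Successor computations. [folklore] -/
theorem succ_gad_last {len n i t : ℕ} (ht : t < len) (ht' : ¬ t + 1 < len) :
    G.succ len n (.gad i t) = .blk (i + 1) G.κ ∧ t = len - 1 :=
  ⟨by simp [succ, ht'], by omega⟩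

/-- The point at a block position. [folklore] -/
@[simp] theorem hd_blk (Ls : List (List ℤ)) (i r : ℕ) : G.hd Ls (.blk i r) = G.M := rfl
/-- The point at a gadget position of the `X`-curve. [folklore] -/
@[simp] theorem hd_gad_X (i t : ℕ) : G.hd G.Xs (.gad i t) = G.xv i t := rfl
/-- The point at a gadget position of the `Y`-curve. [folklore] -/
@[simp] theorem hd_gad_Y (j u : ℕ) : G.hd G.Ys (.gad j u) = G.yv j u := rfl

/-- The cost at a block/block pair vanishes. [folklore] -/
theorem cost_bb : ((G.M - G.M).natAbs : ℤ) = 0 := by simp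


/-- **Local consistency, the `X`-side moves.** [folklore] -/
theorem local_x (hW : G.WF) {s s' : St} (hs : G.Live G.ℓx G.N s) (hs' : G.Live G.ℓy G.m s') :
    ((G.φ s s').toNat : ℕ∞) ≤ ((G.hd G.Xs s - G.hd G.Ys s').natAbs : ℕ∞) + G.Φ (G.succ G.ℓx G.N s) s' := by
  have hℓx := hW.one_le_ℓx
  cases s with
  | blk i r =>
    obtain ⟨hi, hr1, hrκ⟩ := hs
    by_cases hr : 1 < r
    · rw [succ_blk_of_lt hr]
      refine step_live ⟨hi, by omega, by omega⟩ hs' ?_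
      cases s' with
      | blk j r' => simp [φ]
      | gad j u =>
        obtain ⟨hj, hu⟩ := hs'
        simpa using φ_bg_le_bg hW hj hu hu (Or.inl rfl) (r₂ := r - 1) (by omega) (by omega)
    · have hr' : r = 1 := by omega
      subst hr'
      by_cases hiN : i < G.N
      · rw [succ_blk_one_of_lt hiN]
        refine step_live ⟨hiN, by omega⟩ hs' ?_
        cases s' with
        | blk j r' => simpa using φ_bb_le_gb hW hiN 1 r' r'
        | gad j u =>
          obtain ⟨hj, hu⟩ := hs'
          simpa using φ_bg_le_gg hW hiN hj hu hu (Or.inl rfl)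
      · have hiN' : i = G.N := by omega
        subst hiN'
        rw [succ_blk_one_self]
        exact step_xend hs'
  | gad i t =>
    obtain ⟨hi, ht⟩ := hs
    by_cases ht1 : t + 1 < G.ℓx
    · rw [succ_gad_of_lt ht1]
      refine step_live ⟨hi, ht1⟩ hs' ?_
      cases s' with
      | blk j r' =>
        obtain ⟨hj, hr1, hrκ⟩ := hs'
        simpa using φ_gb_le_gb hW hi ht ht1 (Or.inr rfl) hr1 (by omega)
      | gad j u =>
        obtain ⟨hj, hu⟩ := hs'
        simpa using φ_gg_le_gg_x hW hi ht1 hj hu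
    · obtain ⟨e, rfl⟩ := succ_gad_last (G := G) (n := G.N) (i := i) ht ht1
      rw [e]
      have hκ : 1 ≤ G.κ := by have := hW.κ_ge; omega
      refine step_live ⟨by omega, hκ, le_rfl⟩ hs' ?_
      cases s' with
      | blk j r' => simpa using φ_gb_le_bb hW hi (j := j) (r' := r') (r₃ := G.κ) (r'' := r')
      | gad j u =>
        obtain ⟨hj, hu⟩ := hs'
        simpa using φ_gg_le_bg hW hi hj hu hu (Or.inl rfl)

/-- **Local consistency, the `Y`-side moves.** [folklore] -/
theorem local_y (hW : G.WF) {s s' : St} (hs : G.Live G.ℓx G.N s) (hs' : G.Live G.ℓy G.m s') :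
    ((G.φ s s').toNat : ℕ∞) ≤ ((G.hd G.Xs s - G.hd G.Ys s').natAbs : ℕ∞) + G.Φ s (G.succ G.ℓy G.m s') := by
  have hℓy := hW.one_le_ℓy
  cases s' with
  | blk j r' =>
    obtain ⟨hj, hr1, hrκ⟩ := hs'
    by_cases hr : 1 < r'
    · rw [succ_blk_of_lt hr]
      refine step_live hs ⟨hj, by omega, by omega⟩ ?_
      cases s with
      | blk i r => simp [φ]
      | gad i t =>
        obtain ⟨hi, ht⟩ := hs
        simpa using φ_gb_le_gb hW hi ht ht (Or.inl rfl) (r'' := r' - 1) (by omega) (by omega)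
    · have hr'' : r' = 1 := by omega
      subst hr''
      by_cases hjm : j < G.m
      · rw [succ_blk_one_of_lt hjm]
        refine step_live hs ⟨hjm, by omega⟩ ?_
        cases s with
        | blk i r => simpa using φ_bb_le_bg hW hjm r 1 r
        | gad i t =>
          obtain ⟨hi, ht⟩ := hs
          simpa using φ_gb_le_gg hW hi ht ht (Or.inl rfl) hjm
      · have hjm' : j = G.m := by omega
        subst hjm'
        rw [succ_blk_one_self]
        exact step_yend hs
  | gad j u =>
    obtain ⟨hj, hu⟩ := hs'
    by_cases hu1 : u + 1 < G.ℓy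
    · rw [succ_gad_of_lt hu1]
      refine step_live hs ⟨hj, hu1⟩ ?_
      cases s with
      | blk i r =>
        obtain ⟨hi, hr1, hrκ⟩ := hs
        simpa using φ_bg_le_bg hW hj hu hu1 (Or.inr rfl) hr1 (by omega)
      | gad i t =>
        obtain ⟨hi, ht⟩ := hs
        simpa using φ_gg_le_gg_y hW hi ht hj hu1
    · obtain ⟨e, rfl⟩ := succ_gad_last (G := G) (n := G.m) (i := j) hu hu1
      rw [e]
      have hκ : 1 ≤ G.κ := by have := hW.κ_ge; omega
      refine step_live hs ⟨by omega, hκ, le_rfl⟩ ?_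
      cases s with
      | blk i r => simpa using φ_bg_le_bb hW hj (i := i) (r := r) (r₂ := r) (r₃ := G.κ)
      | gad i t =>
        obtain ⟨hi, ht⟩ := hs
        simpa using φ_gg_le_gb hW hi ht ht (Or.inl rfl) hj

/-- **Local consistency, both sides move.** [folklore] -/
theorem local_diag (hW : G.WF) {s s' : St} (hs : G.Live G.ℓx G.N s) (hs' : G.Live G.ℓy G.m s') :
    ((G.φ s s').toNat : ℕ∞) ≤ ((G.hd G.Xs s - G.hd G.Ys s').natAbs : ℕ∞) +
      G.Φ (G.succ G.ℓx G.N s) (G.succ G.ℓy G.m s') := by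
  have hℓx := hW.one_le_ℓx
  have hℓy := hW.one_le_ℓy
  have hκ : 1 ≤ G.κ := by have := hW.κ_ge; omega
  cases s with
  | blk i r =>
    obtain ⟨hi, hr1, hrκ⟩ := hs
    by_cases hr : 1 < r
    · -- x stays in its block
      rw [succ_blk_of_lt hr]
      have hlx : G.Live G.ℓx G.N (.blk i (r - 1)) := ⟨hi, by omega, by omega⟩
      cases s' with
      | blk j r' =>
        obtain ⟨hj, hr1', hrκ'⟩ := hs'
        by_cases hr' : 1 < r'
        · rw [succ_blk_of_lt hr']
          exact step_live hlx ⟨hj, by omega, by omega⟩ (by simp [φ])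
        · have e : r' = 1 := by omega
          subst e
          by_cases hjm : j < G.m
          · rw [succ_blk_one_of_lt hjm]
            exact step_live hlx ⟨hjm, by omega⟩ (by simpa using φ_bb_le_bg hW hjm r 1 (r - 1))
          · have e : j = G.m := by omega
            subst e
            rw [succ_blk_one_self]; exact step_yend hlx
      | gad j u =>
        obtain ⟨hj, hu⟩ := hs'
        by_cases hu1 : u + 1 < G.ℓy
        · rw [succ_gad_of_lt hu1]
          exact step_live hlx ⟨hj, hu1⟩ (by simpa using φ_bg_le_bg hW hj hu hu1 (Or.inr rfl) (r₂ := r - 1) (by omega) (by omega))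
        · obtain ⟨e, rfl⟩ := succ_gad_last (G := G) (n := G.m) (i := j) hu hu1
          rw [e]
          exact step_live hlx ⟨by omega, hκ, le_rfl⟩ (by simpa using φ_bg_le_bb hW hj (i := i) (r := r) (r₂ := r - 1) (r₃ := G.κ))
    · have e : r = 1 := by omega
      subst e
      by_cases hiN : i < G.N
      · -- x enters its gadget
        rw [succ_blk_one_of_lt hiN]
        have hlx : G.Live G.ℓx G.N (.gad i 0) := ⟨hiN, by omega⟩
        cases s' with
        | blk j r' =>
          obtain ⟨hj, hr1', hrκ'⟩ := hs'
          by_cases hr' : 1 < r'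
          · rw [succ_blk_of_lt hr']
            exact step_live hlx ⟨hj, by omega, by omega⟩ (by simpa using φ_bb_le_gb hW hiN 1 r' (r' - 1))
          · have e : r' = 1 := by omega
            subst e
            by_cases hjm : j < G.m
            · rw [succ_blk_one_of_lt hjm]
              exact step_live hlx ⟨hjm, by omega⟩ (by simpa using φ_bb_le_gg hW hiN hjm 1 1)
            · have e : j = G.m := by omega
              subst e
              rw [succ_blk_one_self]; exact step_yend hlx
        | gad j u =>
          obtain ⟨hj, hu⟩ := hs'
          by_cases hu1 : u + 1 < G.ℓy
          · rw [succ_gad_of_lt hu1]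
            exact step_live hlx ⟨hj, hu1⟩ (by simpa using φ_bg_le_gg hW hiN hj hu hu1 (Or.inr rfl))
          · obtain ⟨e, rfl⟩ := succ_gad_last (G := G) (n := G.m) (i := j) hu hu1
            rw [e]
            exact step_live hlx ⟨by omega, hκ, le_rfl⟩ (by simpa using φ_bg_le_gb hW hiN hj)
      · -- x exhausts its curve
        have e : i = G.N := by omega
        subst e
        rw [succ_blk_one_self]
        cases s' with
        | blk j r' =>
          obtain ⟨hj, hr1', hrκ'⟩ := hs'
          by_cases hr' : 1 < r'
          · rw [succ_blk_of_lt hr']; exact step_xend ⟨hj, by omega, by omega⟩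
          · have e : r' = 1 := by omega
            subst e
            by_cases hjm : j < G.m
            · rw [succ_blk_one_of_lt hjm]; exact step_xend ⟨hjm, by omega⟩
            · have e : j = G.m := by omega
              subst e
              rw [succ_blk_one_self]
              exact step_end (by rw [φ_bb_end]; positivity)
        | gad j u =>
          obtain ⟨hj, hu⟩ := hs'
          by_cases hu1 : u + 1 < G.ℓy
          · rw [succ_gad_of_lt hu1]; exact step_xend ⟨hj, hu1⟩
          · obtain ⟨e, rfl⟩ := succ_gad_last (G := G) (n := G.m) (i := j) hu hu1
            rw [e]; exact step_xend ⟨by omega, hκ, le_rfl⟩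
  | gad i t =>
    obtain ⟨hi, ht⟩ := hs
    by_cases ht1 : t + 1 < G.ℓx
    · -- x stays in its gadget
      rw [succ_gad_of_lt ht1]
      have hlx : G.Live G.ℓx G.N (.gad i (t + 1)) := ⟨hi, ht1⟩
      cases s' with
      | blk j r' =>
        obtain ⟨hj, hr1', hrκ'⟩ := hs'
        by_cases hr' : 1 < r'
        · rw [succ_blk_of_lt hr']
          exact step_live hlx ⟨hj, by omega, by omega⟩
            (by simpa using φ_gb_le_gb hW hi ht ht1 (Or.inr rfl) (r'' := r' - 1) (by omega) (by omega))
        · have e : r' = 1 := by omega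
          subst e
          by_cases hjm : j < G.m
          · rw [succ_blk_one_of_lt hjm]
            exact step_live hlx ⟨hjm, by omega⟩ (by simpa using φ_gb_le_gg hW hi ht ht1 (Or.inr rfl) hjm)
          · have e : j = G.m := by omega
            subst e
            rw [succ_blk_one_self]; exact step_yend hlx
      | gad j u =>
        obtain ⟨hj, hu⟩ := hs'
        by_cases hu1 : u + 1 < G.ℓy
        · rw [succ_gad_of_lt hu1]
          exact step_live hlx ⟨hj, hu1⟩ (by simpa using φ_gg_le_gg_diag hW hi ht1 hj hu1)
        · obtain ⟨e, rfl⟩ := succ_gad_last (G := G) (n := G.m) (i := j) hu hu1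
          rw [e]
          exact step_live hlx ⟨by omega, hκ, le_rfl⟩ (by simpa using φ_gg_le_gb hW hi ht ht1 (Or.inr rfl) hj)
    · -- x leaves its gadget
      obtain ⟨e, rfl⟩ := succ_gad_last (G := G) (n := G.N) (i := i) ht ht1
      rw [e]
      have hlx : G.Live G.ℓx G.N (.blk (i + 1) G.κ) := ⟨by omega, hκ, le_rfl⟩
      cases s' with
      | blk j r' =>
        obtain ⟨hj, hr1', hrκ'⟩ := hs'
        by_cases hr' : 1 < r'
        · rw [succ_blk_of_lt hr']
          exact step_live hlx ⟨hj, by omega, by omega⟩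
            (by simpa using φ_gb_le_bb hW hi (j := j) (r' := r') (r₃ := G.κ) (r'' := r' - 1))
        · have e : r' = 1 := by omega
          subst e
          by_cases hjm : j < G.m
          · rw [succ_blk_one_of_lt hjm]
            exact step_live hlx ⟨hjm, by omega⟩ (by simpa using φ_gb_le_bg hW hi hjm)
          · have e : j = G.m := by omega
            subst e
            rw [succ_blk_one_self]; exact step_yend hlx
      | gad j u =>
        obtain ⟨hj, hu⟩ := hs'
        by_cases hu1 : u + 1 < G.ℓy
        · rw [succ_gad_of_lt hu1]
          exact step_live hlx ⟨hj, hu1⟩ (by simpa using φ_gg_le_bg hW hi hj hu hu1 (Or.inr rfl))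
        · obtain ⟨e', rfl⟩ := succ_gad_last (G := G) (n := G.m) (i := j) hu hu1
          rw [e']
          exact step_live hlx ⟨by omega, hκ, le_rfl⟩ (by simpa using φ_gg_le_bb hW hi hj (r₃ := G.κ) (r₄ := G.κ))

/-- **Local consistency of the potential**: at every pair of proper positions,
`Φ ≤ |x - y| + min (Φ succ succ') (min (Φ succ ·) (Φ · succ'))`. [folklore] -/
theorem local_le (hW : G.WF) {s s' : St} (hs : G.Live G.ℓx G.N s) (hs' : G.Live G.ℓy G.m s') :
    ((G.φ s s').toNat : ℕ∞) ≤ ((G.hd G.Xs s - G.hd G.Ys s').natAbs : ℕ∞) +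
      min (G.Φ (G.succ G.ℓx G.N s) (G.succ G.ℓy G.m s'))
        (min (G.Φ (G.succ G.ℓx G.N s) s') (G.Φ s (G.succ G.ℓy G.m s'))) := by
  rw [← min_add_add_left, ← min_add_add_left]
  exact le_min (local_diag hW hs hs') (le_min (local_x hW hs hs') (local_y hW hs hs'))

/-- **The potential is a lower bound** of the distance of the suffixes, at every pair of
positions (proper or past-the-end). Induction on the total remaining length along the DTW
recursion. [folklore] -/
theorem Φ_le_dtwDist (hW : G.WF) : ∀ (n : ℕ) (s s' : St),
    (G.Live G.ℓx G.N s ∨ s = .blk G.N 0) → (G.Live G.ℓy G.m s' ∨ s' = .blk G.m 0) →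
    (G.suf G.Xs s).length + (G.suf G.Ys s').length = n →
    G.Φ s s' ≤ dtwDist (G.suf G.Xs s) (G.suf G.Ys s') := by
  have hκ : 1 ≤ G.κ := by have := hW.κ_ge; omega
  have hlenX : ∀ i, i < G.N → (G.Xs.getD i []).length = G.ℓx := hW.len_X
  have hlenY : ∀ j, j < G.m → (G.Ys.getD j []).length = G.ℓy := hW.len_Y
  intro n
  induction n using Nat.strong_induction_on with
  | _ n ih =>
    intro s s' hs hs' hn
    rcases hs with hs | rfl <;> rcases hs' with hs' | rfl
    · -- both proper: unfold one step of the recursion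
      have ex := suf_eq_cons (G := G) (Ls := G.Xs) (n := G.N) rfl hlenX hs
      have ey := suf_eq_cons (G := G) (Ls := G.Ys) (n := G.m) rfl hlenY hs'
      have hx1 : (G.suf G.Xs s).length = (G.suf G.Xs (G.succ G.ℓx G.N s)).length + 1 := by
        rw [ex, List.length_cons]
      have hy1 : (G.suf G.Ys s').length = (G.suf G.Ys (G.succ G.ℓy G.m s')).length + 1 := by
        rw [ey, List.length_cons]
      rw [ex, ey, dtwDist_cons_cons, Φ_of_live hs hs']
      refine (local_le hW hs hs').trans (add_le_add_right ?_ _)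
      have hsx := live_succ_or (G := G) (n := G.N) hW.one_le_ℓx hκ hs
      have hsy := live_succ_or (G := G) (n := G.m) hW.one_le_ℓy hκ hs'
      refine min_le_min ?_ (min_le_min ?_ ?_)
      · exact ih _ (by omega) _ _ hsx hsy rfl
      · have := ih _ (by omega) _ _ hsx (Or.inl hs') rfl
        rwa [ey] at this
      · have := ih _ (by omega) _ _ (Or.inl hs) hsy rfl
        rwa [ex] at this
    · rw [suf_end (G := G) (Ls := G.Ys) (n := G.m) rfl, show G.Φ s (.blk G.m 0) = ⊤ by simp [Φ, ne_end_of_live hs]]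
      rw [suf_eq_cons (G := G) (Ls := G.Xs) (n := G.N) rfl hlenX hs, dtwDist_cons_nil]
    · rw [suf_end (G := G) (Ls := G.Xs) (n := G.N) rfl, show G.Φ (.blk G.N 0) s' = ⊤ by simp [Φ, ne_end_of_live hs']]
      rw [suf_eq_cons (G := G) (Ls := G.Ys) (n := G.m) rfl hlenY hs', dtwDist_nil_cons]
    · rw [suf_end (G := G) (Ls := G.Xs) (n := G.N) rfl, suf_end (G := G) (Ls := G.Ys) (n := G.m) rfl,
        dtwDist_nil_nil, Φ_end_end]

/-- **The lower bound for the bundled setup**: `(N - m) σ + Σ_j mv j ≤ dtwDist x y`.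
[cite: BringmannKunnemannFOCS2015, Lemma 6.3] -/
theorem lower_bound (hW : G.WF) :
    ((G.R G.N G.m (G.Ssum 0)).toNat : ℕ∞) ≤ dtwDist (ga G.M G.κ G.Xs) (ga G.M G.κ G.Ys) := by
  have hκ : 1 ≤ G.κ := by have := hW.κ_ge; omega
  have hs : G.Live G.ℓx G.N (.blk 0 G.κ) := ⟨Nat.zero_le _, hκ, le_rfl⟩
  have hs' : G.Live G.ℓy G.m (.blk 0 G.κ) := ⟨Nat.zero_le _, hκ, le_rfl⟩
  have h := Φ_le_dtwDist hW _ _ _ (Or.inl hs) (Or.inl hs') rfl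
  rw [suf_start, suf_start, Φ_of_live hs hs'] at h
  simpa [φ] using h

end assembly

end GASetup

namespace GASetup

/-- **Lower bound for the alignment gadget (Bringmann–Künnemann, FOCS 2015, Lemma 6.3, weak
form).** Under the hypotheses `WF` (common length `ℓx` and sum `sx` of the `X`-gadgets, common
length `ℓy` of the `Y`-gadgets, values in `[0, z]`, `M = 2z`, `κ ≥ 4 (ℓx + ℓy) + 1`, claimed
column bounds `mv j ≤ δ(X_i, Y_j)` with `mv j ≤ λ_j`): every natural number `v` with
`v ≤ Σ_{j < m} mv j + σ · (N - m)` (`σ = ℓx M - sx`, truncated subtraction) is a lower bound of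
`dtwDist (ga M κ Xs) (ga M κ Ys)`. [cite: BringmannKunnemannFOCS2015, Lemma 6.3] -/
theorem le_dtwDist_ga_ga {G : GASetup} (hW : G.WF) (v : ℕ)
    (hv : (v : ℤ) ≤ (∑ k ∈ Finset.range G.m, (G.mv k : ℤ)) + G.σ * ((G.N - G.m : ℕ) : ℤ)) :
    (v : ℕ∞) ≤ dtwDist (ga G.M G.κ G.Xs) (ga G.M G.κ G.Ys) := by
  refine le_trans ?_ (lower_bound hW)
  have h : (v : ℤ) ≤ G.R G.N G.m (G.Ssum 0) := by
    unfold R Ssum; rwa [Finset.range_eq_Ico] at hv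
  exact_mod_cast (show v ≤ (G.R G.N G.m (G.Ssum 0)).toNat by omega)

end GASetup

end DTWRed

end Literature.Computability.FineGrained
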